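import Literature.MathematicalPhysics.QuantumFieldTheory.Balaban1983to89.B9SupplySockB9P3ZdAtFamilies

/-!
# `Balaban1983to89.B9SupplySockB9P3ZdAtJoint` — THE J-N06→N05 JUNCTION WITH ONE OPENING OF [4] THEOREM 3.3: the family suppliers of
# `B9SupplySockB9P3ZdAtFamilies` at EXPLICIT constants, and the JOINT ∃-packagings delivering ONE constant tuple for every b9 socket a knit consumes
# (`SB9all` ∧ `SB9srcH` ∧ `SH59src` at the `Ω₀ = ℤᵈ` members; the four-line collar family ∧ `SH59D` over the cube subtype of (1.131))

statement-level skeleton of published theorems with citation tags; proofs where landed; nothing here is a claim about the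
Yang–Mills mass gap

PDF held: `paper:balaban1985-cmp99-background-propagators` ([4] = B9; journal page = PDF page + 388), pp. 394–399, 404; `paper:balaban1985-cmp99-regular-spaces-
gauge-fixing` (B8; journal page = PDF page + 74), pp. 77, 86–88, 92, 99, 101.

WHY THIS FILE (cell `pub-ymgap`, seat `pub-ymgap-dag-n06-b` g6; count-neutral).  Referee ref-A (READ-11 on p527062, KNIT-NOTE «one-B₀») located a
composability defect of the landed family suppliers: the N05 record knit (dag-n05-d, `BalabanUVNodesN05SubBHKnitUnivT8Srv`, p521275) takes ONE `λ.inp.B₀`,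
ONE `λ.B₀β` across its three b9 binders `SB9all` ∕ `SH59src` ∕ `SB9srcH`, while `sockB9P3_allLevels_of_thm33_univ_on`, `sockH59src_of_thm33_univ_on`,
`sockB9P3srcH_of_thm33_univ_on` each open `B9.Thm33Printed` separately and quantify their own `∃ B₀′` (the same expression in all three proofs, but not
STATED equal); likewise dag-n05-e's cube-line knit (`B8LeafKnitZd3CubBdry4.prop6Printed_zdCub_bdry₅_d4`) shares `inp.B₀`, `Bbd`, `cP` between `SH59D`
and the per-cube four-line clause, while `sh59D_cubeSubfamily_of_thm33_on` and `sockB9P3D4_allLevels_of_thm33_on` quantify separately.  This file is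
ref-A's option (b): the suppliers re-stated with Theorem 3.3's `G(U)`-block at NAMED constants as the hypothesis (§1, §3 — the caller opens the
existential ONCE), and two JOINT theorems (§2 `sockUniv_joint_of_thm33_on`, §3 `sockCube_joint_of_thm33_on`) producing a SINGLE constant tuple for all
the sockets of each consumer, with the consumer-chosen constants (`B₈`, `B₀″`) quantified AFTER the tuple and only the threshold `c59 ≤ cP` depending on them.

WHAT IS PROVED (kernel, 0 sorry, theorems only; same constants as the landed suppliers).
* §1 `sockB9P3D4_allLevels_explicit_on`, `sockB9P3_allLevels_univ_explicit_on`, `sockB9P3srcH_univ_explicit_on`, `sockH59src_univ_explicit_on`: the four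
  family forms of `B9SupplySockB9P3ZdAtFamilies` §1–§2 with hypothesis `H : ∀ i, M₁ ≤ (geo i).M → ∀ α₀ > 0, (geo i).M·α₀ ≤ a₀ → ∀ U, Reg335 c35 α₀ U →
  Ineq342_346_347 (GA i) B₀ δ₀ U ∧ Ineq343_345 (GA i) Bβ Bε Bεβ δ₀ U` (the `G(U)`-half of `B9.Thm33Printed`'s body), any block parameter
  `M ≥ max{1, M₁, M₃}`, conclusions at B₀′ = max{1, 2B₀max{1,q}}, B₀β′ = 2max{0, C_H Bβ(β)}max{1,q}, cP = min{1∕16, c₆∕M, a₀∕(K₆M), a₃∕(K₆M),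
  1∕(2B₀c₆₉K₆M+1)}, γ′ = γ″ = 2c_Sγ₈∕B₀′, γβ = (max{0, C_H Bβ(β)}c_S∕B₀ + c_Sβ)γ₈, c59 = min cP (cP∕K₀), K₀ = 2L·5dLB₈ + 8·8B₀″·5dLB₈.
* §2 ★★ `sockUniv_joint_of_thm33_on`: from `h33 : B9.Thm33Printed c35 geo bg Gp GA` and the At-binders over `ι` only — `∃ B₀′ B₀β′ cP γ′ γβ` (positivity) with
  (i) `∀ j m ≤ k, SockB9P3 L B₀′ B₀β′ cP β len …` (`SB9all`), (ii) the `SB9srcH` body at `(B₀′, B₀β′, cP, γ′, γβ)`, (iii) `∀ B₈ > 0, ∀ B₀″ ≥ 0, ∃ c59,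
  0 < c59 ≤ cP ∧` the `SH59src` body at `(B₀′, B₈, B₀″, c59, γ′)`.
* §3 `sh59D_cube_explicit_on` and ★★ `sockCube_joint_of_thm33_on`: over the cube subtype — `∃ B₀ cP` with (i) `∀ i m ≤ k, SockB9P3D4 L B₀′ ((20d+2)B₀′) cP …`,
  (ii) `∀ B₀″ ≥ 0, ∃ c59, 0 < c59 ≤ cP ∧` the `SH59D` body at `(B₀′, B₀″, (20d+2)B₀′, c59)`, B₀′ = max{1, 2B₀max{1,q}}.

HONEST SCOPE.  ∃-bookkeeping over `B9SupplySockB9P3ZdAt` §2 (the member-level theorems are applied verbatim); nothing of [4] proved; every binder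
remains a HYPOTHESIS of printed shape at the members in the image of `ι` (N06's object-bound: the letters as operators, `Thm33Printed` at an instance,
joint satisfiability by print's objects — not claimed, ref-A WATCH-JSAT).  Count-neutral; N05∕N06 NOT discharged; one finite lattice programme; nothing
continuum ∕ ℝ⁴ ∕ OS ∕ mass-gap ∕ Clay.  Unit `pub-ymgap-dag-n06-b` (g6), 2026-08-27.
-/

noncomputable section

open NormedSpace

namespace Literature.MathematicalPhysics.QuantumFieldTheory.Balaban1983to89.B9SupplySockB9P3ZdAtJoint


open Complex (I)
open MatrixLog B7Prop1Explicit B7Prop2Explicit B7Prop1Local B7Eq92Concrete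
open B7Prop4GeneralLevels (linCovIter)
open B8Ineq132 (covDerivFwd covDeriv InAk BondTouches)
open B8Eq119TwistedAxial (Restr129 InAx)
open B8Eq184Proof (cfgExp)
open B8Lemma1NonAbelian (mulCfg)
open B8Eq140Level (SideTouches)
open B8Eq146AExpansion (iEta plaqCovDeriv)
open B8Eq143PlaqExpansion (pdiv)
open B8Eq155JBound (Jcur wsup)
open B8ScaledSupNorm (bondNorm msup weight Bdd)
open B8Eq138LandauZd (IsLandau138 IsLandau138W IsLandau146 IsLandau146W InR138 QT covDivB logCfg covLap)
open B8LanF146 (LanF146)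
open B8LeafModelZd (ZdIdx)
open B8LeafModelZd3 (SockB9P3)
open B8Eq131CubesAdmissible (cubeFam)
open B8CubeMemberZd (cubeLamS cubeLamB)
open B9Eq340HolderZd (hquot AdmPair)
open B9SupplySockB9P3ZdLetters (OpsZd)
open B9SupplySockB9P3ZdLettersOmega (Margin2 SockB9P3D4)
open B9SupplySockB9P3ZdAt (DictAt Prop6At InvAt CurvAt LandauAt AvgAt HolderAt GopAddAt SrcAt SrcHolderAt sockB9P3D4_at' sockB9P3_at_univ'
  sockSrc_core_at_univ')
open B8Prop3GaugeFixedKLevel (mem_unitaryUnits_of_mgauge_eq mulCfg_eq_gaugeAct_of_mgauge_eq)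

-- `Site` alone could resolve to the torus sites of `Setup.lean`; re-export the `ℤ^d` sites of `B7Prop1Explicit`.
export B7Prop1Explicit (Site)

variable {d : ℕ} {𝔸 : Type*} [CStarAlgebra 𝔸] [Nontrivial 𝔸]

/-! ## §1 The family forms at EXPLICIT constants (Theorem 3.3's `G(U)`-block at named constants as the hypothesis) -/

section Supply

variable {I : Type} (geo : I → B9.Geometry) (bg : I → B9.Backgrounds) (GA : ∀ i, B9.KernelFamily (geo i) (bg i))
variable (L : ℕ) (mem : ℝ → ZdIdx d L → ℕ → I)
variable (ιCfg : ∀ (M : ℝ) (i : ZdIdx d L) (m : ℕ) (U₀ : Site d → Fin d → 𝔸ˣ),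
  (∀ x κ, U₀ x κ ∈ unitaryUnits 𝔸) → (bg (mem M i m)).Cfg)
variable (ιLoc : ∀ (M : ℝ) (i : ZdIdx d L) (m : ℕ), (Site d → Fin d → 𝔸) → (geo (mem M i m)).Loc)
variable (ops : ℝ → ZdIdx d L → ℕ → OpsZd d 𝔸)

/-- **(EXPLICIT CONSTANTS.)  THE FOUR-LINE COLLAR SOCKET AT EVERY MEMBER WITH `Margin2` AND EVERY TRUNCATION LEVEL, FROM THEOREM 3.3's `G(U)`-BLOCK AT NAMED
CONSTANTS** — `B9SupplySockB9P3ZdAtFamilies.sockB9P3D4_allLevels_of_thm33_on` with the existential of `B9.Thm33Printed` opened by the caller: the hypothesis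
`H` is the `G(U)`-half of Theorem 3.3's body at constants `M₁, δ₀, a₀, B₀, Bβ, Bε, Bεβ` (p. 399 «with the constants described there»), the block parameter is
any `M ≥ max{1, M₁, M₃}`, and the conclusion is `SockB9P3D4` at B₀′ = max{1, 2B₀max{1,q}}, B_∂ = (20d+2)B₀′, cP = min{1∕16, c₆∕M, a₀∕(K₆M), a₃∕(K₆M),
1∕(2B₀c₆₉K₆M+1)} — so that ONE opening of Theorem 3.3 serves every socket a consumer knits (the one-B₀ shape).
[cite: Balaban1985RegularSpaces, (1.59) p.86, Prop. 3 p.87, Thm 4 p.88, (1.131) p.99; Balaban1985BackgroundPropagators, Thm 3.3 p.399, (3.27) p.395] -/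
theorem sockB9P3D4_allLevels_explicit_on (hd2 : 2 ≤ d) (hL : 1 ≤ L) {c35 c₆ K₆ M₃ a₃ c69 q : ℝ}
    {M₁ δ₀ a₀ B₀ : ℝ} {Bβ Bε : ℝ → ℝ} {Bεβ : ℝ → ℝ → ℝ} (hB₀ : 0 < B₀)
    (H : ∀ i : I, M₁ ≤ (geo i).M → ∀ α₀ : ℝ, 0 < α₀ → (geo i).M * α₀ ≤ a₀ →
      ∀ U : (bg i).Cfg, (bg i).Reg335 c35 α₀ U →
        B9.Ineq342_346_347 (GA i) B₀ δ₀ U ∧ B9.Ineq343_345 (GA i) Bβ Bε Bεβ δ₀ U)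
    {M : ℝ} (hM1 : 1 ≤ M) (hMM₁ : M₁ ≤ M) (hMM₃ : M₃ ≤ M)
    {J : Type*} (ι : J → ZdIdx d L) (hMJ : ∀ j, Margin2 (ι j).Ω)
    (hdict : ∀ (M : ℝ) (j : J) (m : ℕ), DictAt geo bg GA L mem ιCfg ιLoc ops M (ι j) m)
    (hP6 : ∀ (M : ℝ) (j : J) (m : ℕ), M₃ ≤ M → Prop6At bg L mem ιCfg c35 c₆ K₆ M (ι j) m)
    (hinv : ∀ (M : ℝ) (j : J) (m : ℕ), M₃ ≤ M → InvAt bg L mem ιCfg ops c35 a₃ M (ι j) m)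
    (hcurv : ∀ (M : ℝ) (j : J) (m : ℕ), M₃ ≤ M → CurvAt bg L mem ιCfg ops c35 a₃ c69 M (ι j) m)
    (hlan : ∀ (M : ℝ) (j : J) (m : ℕ), M₃ ≤ M → LandauAt bg L mem ιCfg ops c35 a₃ M (ι j) m)
    (havg : ∀ (M : ℝ) (j : J) (m : ℕ), AvgAt L ops q M (ι j) m)
    (hK₆ : 0 < K₆) (hc69 : 0 ≤ c69) (hq : 0 ≤ q) :
    ∀ (j : J) (m : ℕ), m ≤ (ι j).k →
      SockB9P3D4 (𝔸 := 𝔸) L (max 1 (2 * B₀ * max 1 q)) ((20 * d + 2) * max 1 (2 * B₀ * max 1 q))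
        (min (1 / 16) (min (c₆ / M) (min (a₀ / (K₆ * M)) (min (a₃ / (K₆ * M)) (1 / (2 * B₀ * c69 * K₆ * M + 1))))))
        (ι j).η m (ι j).Ω (ι j).Λs (ι j).Λb := by
  intro j m hm
  refine sockB9P3D4_at' geo bg GA L mem ιCfg ιLoc ops hd2 hL hM1 (ι j) (hMJ j) hm (hdict M j m) (hP6 M j m hMM₃) (hinv M j m hMM₃)
    (hcurv M j m hMM₃) (hlan M j m hMM₃) (havg M j m) hK₆ hc69 hq (δ₀ := δ₀) hB₀ fun α₀ U₀ hU₀ hα₀ hMa hreg => ?_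
  have hMi : M₁ ≤ (geo (mem M (ι j) m)).M := by rw [(hdict M j m).1]; exact hMM₁
  have hMa' : (geo (mem M (ι j) m)).M * α₀ ≤ a₀ := by rw [(hdict M j m).1]; exact hMa
  exact (H (mem M (ι j) m) hMi α₀ hα₀ hMa' (ιCfg M (ι j) m U₀ hU₀) hreg).1

/-- **(EXPLICIT CONSTANTS.)  THE ORIGINAL FIVE-LINE SOCKET `SockB9P3` (`SB9all`) AT EVERY MEMBER WITH `Ω₀ = ℤᵈ` AND EVERY TRUNCATION LEVEL, FROM THEOREM 3.3's
`G(U)`-BLOCK AT NAMED CONSTANTS** — `B9SupplySockB9P3ZdAtFamilies.sockB9P3_allLevels_of_thm33_univ_on` with the existential opened by the caller; conclusion at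
B₀′ = max{1, 2B₀max{1,q}}, B₀β′ = 2max{0, C_H Bβ(β)}max{1,q}, cP as above, block parameter any `M ≥ max{1, M₁, M₃}`.
[cite: Balaban1985RegularSpaces, (1.59) p.86, Prop. 3 p.87, Thm 4 p.88, p.77; Balaban1985BackgroundPropagators, Thm 3.3 p.399] -/
theorem sockB9P3_allLevels_univ_explicit_on (hd2 : 2 ≤ d) (hL : 1 ≤ L) {c35 c₆ K₆ M₃ a₃ c69 q CH β : ℝ} {len : Site d → ℝ}
    {M₁ δ₀ a₀ B₀ : ℝ} {Bβ Bε : ℝ → ℝ} {Bεβ : ℝ → ℝ → ℝ} (hB₀ : 0 < B₀)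
    (H : ∀ i : I, M₁ ≤ (geo i).M → ∀ α₀ : ℝ, 0 < α₀ → (geo i).M * α₀ ≤ a₀ →
      ∀ U : (bg i).Cfg, (bg i).Reg335 c35 α₀ U →
        B9.Ineq342_346_347 (GA i) B₀ δ₀ U ∧ B9.Ineq343_345 (GA i) Bβ Bε Bεβ δ₀ U)
    {M : ℝ} (hM1 : 1 ≤ M) (hMM₁ : M₁ ≤ M) (hMM₃ : M₃ ≤ M)
    {J : Type*} (ι : J → ZdIdx d L) (hΩJ : ∀ j, (ι j).Ω 0 = Set.univ)
    (hdict : ∀ (M : ℝ) (j : J) (m : ℕ), DictAt geo bg GA L mem ιCfg ιLoc ops M (ι j) m)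
    (hP6 : ∀ (M : ℝ) (j : J) (m : ℕ), M₃ ≤ M → Prop6At bg L mem ιCfg c35 c₆ K₆ M (ι j) m)
    (hinv : ∀ (M : ℝ) (j : J) (m : ℕ), M₃ ≤ M → InvAt bg L mem ιCfg ops c35 a₃ M (ι j) m)
    (hcurv : ∀ (M : ℝ) (j : J) (m : ℕ), M₃ ≤ M → CurvAt bg L mem ιCfg ops c35 a₃ c69 M (ι j) m)
    (hlan : ∀ (M : ℝ) (j : J) (m : ℕ), M₃ ≤ M → LandauAt bg L mem ιCfg ops c35 a₃ M (ι j) m)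
    (havg : ∀ (M : ℝ) (j : J) (m : ℕ), AvgAt L ops q M (ι j) m)
    (hhol : ∀ (M : ℝ) (j : J) (m : ℕ), HolderAt geo bg GA L mem ιCfg ops β len CH M (ι j) m)
    (hK₆ : 0 < K₆) (hc69 : 0 ≤ c69) (hq : 0 ≤ q) :
    ∀ (j : J) (m : ℕ), m ≤ (ι j).k →
      SockB9P3 (𝔸 := 𝔸) L (max 1 (2 * B₀ * max 1 q)) (2 * max 0 (CH * Bβ β) * max 1 q)
        (min (1 / 16) (min (c₆ / M) (min (a₀ / (K₆ * M)) (min (a₃ / (K₆ * M)) (1 / (2 * B₀ * c69 * K₆ * M + 1))))))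
        β len (ι j).η m (ι j).Ω (ι j).Λs (ι j).Λb := by
  intro j m _
  refine sockB9P3_at_univ' geo bg GA L mem ιCfg ιLoc ops hd2 hL hM1 (ι j) (hΩJ j) m (hdict M j m) (hP6 M j m hMM₃) (hinv M j m hMM₃)
    (hcurv M j m hMM₃) (hlan M j m hMM₃) (havg M j m) (hhol M j m) hK₆ hc69 hq
    (δ₀ := δ₀) (Bε := Bε) (Bεβ := Bεβ) hB₀ fun α₀ U₀ hU₀ hα₀ hMa hreg => ?_
  have hMi : M₁ ≤ (geo (mem M (ι j) m)).M := by rw [(hdict M j m).1]; exact hMM₁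
  have hMa' : (geo (mem M (ι j) m)).M * α₀ ≤ a₀ := by rw [(hdict M j m).1]; exact hMa
  exact H (mem M (ι j) m) hMi α₀ hα₀ hMa' (ιCfg M (ι j) m U₀ hU₀) hreg

/-- **(EXPLICIT CONSTANTS.)  THE `SB9srcH` BODY OF THE N05 RECORD KNIT AT THE `Ω₀ = ℤᵈ` MEMBERS, FROM THEOREM 3.3's `G(U)`-BLOCK AT NAMED CONSTANTS** —
`B9SupplySockB9P3ZdAtFamilies.sockB9P3srcH_of_thm33_univ_on` with the existential opened by the caller; the five (1.59) lines at the top level with the source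
allowances at B₀′ = max{1, 2B₀max{1,q}}, B₀β′ = 2max{0, C_H Bβ(β)}max{1,q}, cP as above, γ″ = 2c_Sγ₈∕B₀′, γβ = (max{0, C_H Bβ(β)}c_S∕B₀ + c_Sβ)γ₈, for the
consumer's γ₈ (any real; the bodies only use `|f|₍₋₂₎ < γ₈(α₀ + α₁)`).
[cite: Balaban1985RegularSpaces, Thm 8 + (1.146) p.101, Prop. 3 p.87, (1.59) p.86; Balaban1985BackgroundPropagators, Thm 3.3 p.399] -/
theorem sockB9P3srcH_univ_explicit_on (hd2 : 2 ≤ d) (hL : 1 ≤ L) {c35 c₆ K₆ M₃ a₃ c69 q CH β cS cSβ : ℝ} {len : Site d → ℝ}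
    {M₁ δ₀ a₀ B₀ : ℝ} {Bβ Bε : ℝ → ℝ} {Bεβ : ℝ → ℝ → ℝ} (hB₀ : 0 < B₀)
    (H : ∀ i : I, M₁ ≤ (geo i).M → ∀ α₀ : ℝ, 0 < α₀ → (geo i).M * α₀ ≤ a₀ →
      ∀ U : (bg i).Cfg, (bg i).Reg335 c35 α₀ U →
        B9.Ineq342_346_347 (GA i) B₀ δ₀ U ∧ B9.Ineq343_345 (GA i) Bβ Bε Bεβ δ₀ U)
    {M : ℝ} (hM1 : 1 ≤ M) (hMM₁ : M₁ ≤ M) (hMM₃ : M₃ ≤ M)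
    {J : Type*} (ι : J → ZdIdx d L) (hΩJ : ∀ j, (ι j).Ω 0 = Set.univ)
    (hdict : ∀ (M : ℝ) (j : J) (m : ℕ), DictAt geo bg GA L mem ιCfg ιLoc ops M (ι j) m)
    (hP6 : ∀ (M : ℝ) (j : J) (m : ℕ), M₃ ≤ M → Prop6At bg L mem ιCfg c35 c₆ K₆ M (ι j) m)
    (hinv : ∀ (M : ℝ) (j : J) (m : ℕ), M₃ ≤ M → InvAt bg L mem ιCfg ops c35 a₃ M (ι j) m)
    (hcurv : ∀ (M : ℝ) (j : J) (m : ℕ), M₃ ≤ M → CurvAt bg L mem ιCfg ops c35 a₃ c69 M (ι j) m)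
    (havg : ∀ (M : ℝ) (j : J) (m : ℕ), AvgAt L ops q M (ι j) m)
    (hhol : ∀ (M : ℝ) (j : J) (m : ℕ), HolderAt geo bg GA L mem ιCfg ops β len CH M (ι j) m)
    (hadd : ∀ (M : ℝ) (j : J) (m : ℕ), GopAddAt L ops M (ι j) m)
    (hsrc : ∀ (M : ℝ) (j : J) (m : ℕ), M₃ ≤ M → SrcAt bg L mem ιCfg ops c35 a₃ cS M (ι j) m)
    (hsrcH : ∀ (M : ℝ) (j : J) (m : ℕ), M₃ ≤ M → SrcHolderAt bg L mem ιCfg ops c35 a₃ β len cSβ M (ι j) m)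
    (hK₆ : 0 < K₆) (hc69 : 0 ≤ c69) (hq : 0 ≤ q) (hcS : 0 ≤ cS) (hcSβ : 0 ≤ cSβ) (γ₈ : ℝ) :
    ∀ jj : J,
      ∀ α₀ α₁ α₂ : ℝ, 0 < α₀ → α₀ ≤ (min (1 / 16) (min (c₆ / M) (min (a₀ / (K₆ * M)) (min (a₃ / (K₆ * M)) (1 / (2 * B₀ * c69 * K₆ * M + 1)))))) → 0 < α₁ → 0 < α₂ → α₂ ≤ (min (1 / 16) (min (c₆ / M) (min (a₀ / (K₆ * M)) (min (a₃ / (K₆ * M)) (1 / (2 * B₀ * c69 * K₆ * M + 1)))))) →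
      ∀ (U₀ W : Site d → Fin d → 𝔸ˣ), (∀ x κ, U₀ x κ ∈ unitaryUnits 𝔸) → (∀ x κ, W x κ ∈ unitaryUnits 𝔸) →
      ∀ f : Site d → 𝔸, InR138 L (ι jj).k (ι jj).η ((ι jj).Ω 0) ((ι jj).Λs (ι jj).k) U₀ f →
      (∀ x, IsSelfAdjoint (f x)) → (∀ x, x ∉ (ι jj).Ω 0 → f x = 0) →
      Bdd L (ι jj).k (ι jj).η (-(2 : ℝ)) (fun j (x : Site d) => x ∈ (ι jj).Ω j) f →
      msup L (ι jj).k (ι jj).η (-(2 : ℝ)) (fun j (x : Site d) => x ∈ (ι jj).Ω j) f < γ₈ * (α₀ + α₁) →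
      msup L (ι jj).k (ι jj).η (-(3 : ℝ)) (fun j (p : Fin d × Site d) => p.2 ∈ (ι jj).Ω j) (fun p => covDerivFwd (ι jj).η U₀ p.1 f p.2) < γ₈ * (α₀ + α₁) →
      InAk L (ι jj).k (ι jj).η α₀ (ι jj).Ω U₀ → InAk L (ι jj).k (ι jj).η α₀ (ι jj).Ω (mulCfg W U₀) →
      IsLandau146W L (ι jj).k (ι jj).η ((ι jj).Ω 0) ((ι jj).Λs (ι jj).k) U₀ f W →
      ∀ A' : Site d → Fin d → 𝔸, (∀ y τ, IsSelfAdjoint (A' y τ)) →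
      (∀ j, j ≤ (ι jj).k → ∀ (y : Site d) (τ : Fin d), SideTouches ((ι jj).Ω j) y τ →
        W y τ = cfgExp (ι jj).η A' y τ ∧ ‖A' y τ‖ ≤ α₂ * ((L : ℝ) ^ j * (ι jj).η)⁻¹) →
      (∀ (y : Site d) (τ : Fin d), (∀ j, j ≤ (ι jj).k → ¬ SideTouches ((ι jj).Ω j) y τ) → A' y τ = 0) →
      msup L (ι jj).k (ι jj).η (-(1 : ℝ)) (fun j (b : Site d × Fin d) => SideTouches ((ι jj).Ω j) b.1 b.2) (fun b => A' b.1 b.2)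
          ≤ (max 1 (2 * B₀ * max 1 q)) * (bondNorm L (ι jj).k (ι jj).η (-(3 : ℝ)) (ι jj).Ω (fun x μ => Jcur (ι jj).η U₀ A' μ x)
            + wsup 1 (fun p : {p : ℕ × (Site d × Fin d) // p.1 ≤ (ι jj).k ∧ p.2 ∈ (ι jj).Λb (ι jj).k p.1} =>
                linCovIter L U₀ (iEta (ι jj).η A') p.1.1 p.1.2.1 p.1.2.2)) + (2 * cS * γ₈ / max 1 (2 * B₀ * max 1 q)) * (max 1 (2 * B₀ * max 1 q)) * (α₀ + α₁) ∧
        msup L (ι jj).k (ι jj).η (-(2 : ℝ)) (fun j (t : Fin d × Fin d × Site d) => SideTouches ((ι jj).Ω j) t.2.2 t.2.1)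
            (fun t => covDerivFwd (ι jj).η U₀ t.1 (fun z => A' z t.2.1) t.2.2)
          ≤ (max 1 (2 * B₀ * max 1 q)) * (bondNorm L (ι jj).k (ι jj).η (-(3 : ℝ)) (ι jj).Ω (fun x μ => Jcur (ι jj).η U₀ A' μ x)
            + wsup 1 (fun p : {p : ℕ × (Site d × Fin d) // p.1 ≤ (ι jj).k ∧ p.2 ∈ (ι jj).Λb (ι jj).k p.1} =>
                linCovIter L U₀ (iEta (ι jj).η A') p.1.1 p.1.2.1 p.1.2.2)) + (2 * cS * γ₈ / max 1 (2 * B₀ * max 1 q)) * (max 1 (2 * B₀ * max 1 q)) * (α₀ + α₁) ∧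
        bondNorm L (ι jj).k (ι jj).η (-(3 : ℝ)) (ι jj).Ω (fun x μ => pdiv (ι jj).η U₀ (plaqCovDeriv (ι jj).η U₀ A') μ x)
          ≤ (max 1 (2 * B₀ * max 1 q)) * (bondNorm L (ι jj).k (ι jj).η (-(3 : ℝ)) (ι jj).Ω (fun x μ => Jcur (ι jj).η U₀ A' μ x)
            + wsup 1 (fun p : {p : ℕ × (Site d × Fin d) // p.1 ≤ (ι jj).k ∧ p.2 ∈ (ι jj).Λb (ι jj).k p.1} =>
                linCovIter L U₀ (iEta (ι jj).η A') p.1.1 p.1.2.1 p.1.2.2)) + (2 * cS * γ₈ / max 1 (2 * B₀ * max 1 q)) * (max 1 (2 * B₀ * max 1 q)) * (α₀ + α₁) ∧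
        bondNorm L (ι jj).k (ι jj).η (-(3 : ℝ)) (ι jj).Ω (fun x μ => covLap (ι jj).η U₀ (fun z => A' z μ) x)
          ≤ (max 1 (2 * B₀ * max 1 q)) * (bondNorm L (ι jj).k (ι jj).η (-(3 : ℝ)) (ι jj).Ω (fun x μ => Jcur (ι jj).η U₀ A' μ x)
            + wsup 1 (fun p : {p : ℕ × (Site d × Fin d) // p.1 ≤ (ι jj).k ∧ p.2 ∈ (ι jj).Λb (ι jj).k p.1} =>
                linCovIter L U₀ (iEta (ι jj).η A') p.1.1 p.1.2.1 p.1.2.2)) + (2 * cS * γ₈ / max 1 (2 * B₀ * max 1 q)) * (max 1 (2 * B₀ * max 1 q)) * (α₀ + α₁) ∧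
        msup L (ι jj).k (ι jj).η (-(2 + β)) (fun j (q : Fin d × Fin d × (Site d × Site d)) => q.2.2 ∈ AdmPair (ι jj).η len ∧ q.2.2.1 ∈ (ι jj).Ω j)
            (fun q => hquot (ι jj).η β len U₀ (covDerivFwd (ι jj).η U₀ q.1 (fun z => A' z q.2.1)) q.2.2)
          ≤ (2 * max 0 (CH * Bβ β) * max 1 q) * (bondNorm L (ι jj).k (ι jj).η (-(3 : ℝ)) (ι jj).Ω (fun x μ => Jcur (ι jj).η U₀ A' μ x)
            + wsup 1 (fun p : {p : ℕ × (Site d × Fin d) // p.1 ≤ (ι jj).k ∧ p.2 ∈ (ι jj).Λb (ι jj).k p.1} =>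
                linCovIter L U₀ (iEta (ι jj).η A') p.1.1 p.1.2.1 p.1.2.2)) + ((max 0 (CH * Bβ β) * cS / B₀ + cSβ) * γ₈) * (α₀ + α₁) := by
  have hM0 : 0 < M := lt_of_lt_of_le one_pos hM1
  have hKM : 0 < K₆ * M := mul_pos hK₆ hM0
  obtain ⟨B', hB'_def⟩ : ∃ B' : ℝ, B' = max 1 (2 * B₀ * max 1 q) := ⟨_, rfl⟩
  have hB'1 : 1 ≤ B' := by rw [hB'_def]; exact le_max_left _ _
  have hB'0 : 0 < B' := lt_of_lt_of_le one_pos hB'1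
  have hCβ0 : 0 ≤ max 0 (CH * Bβ β) := le_max_left _ _
  rw [← hB'_def]
  intro jj α₀ α₁ α₂ hα₀ hα₀c hα₁ hα₂ hα₂c U₀ W hU₀ hWu f _ _ _ hfB hfF _ hInA _ hLW A' _ h41 hA0
  have hη : 0 < (ι jj).η := (ι jj).hη
  have hα₂16 : α₂ ≤ 1 / 16 := hα₂c.trans (min_le_left _ _)
  -- the multiplier clause for A′ = (iη)⁻¹ log W on every bond
  have hlog : ∀ (x : Site d) (μ : Fin d), BondTouches ((ι jj).Ω 0) x μ → logCfg (ι jj).η W x μ = A' x μ :=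
    fun x μ _ => B9SupplySockB9P3ZdSrc.logCfg_eq_of_univ L hd2 hη (hΩJ jj) U₀ hWu hα₂16 h41 x μ
  have hcl : ∃ μ : ℕ → Site d → 𝔸, ∀ x ∈ (ι jj).Ω 0,
      covLap (ι jj).η U₀ (((ι jj).Ω 0).indicator (covDivB (ι jj).η U₀ A' - f)) x = QT L (ι jj).k ((ι jj).Λs (ι jj).k) U₀ μ x :=
    (B9SupplySockB9P3ZdSrc.mulClause_congr f hlog).1 hLW.2
  have h33U : ∀ (α : ℝ) (V : Site d → Fin d → 𝔸ˣ) (hV : ∀ x κ, V x κ ∈ unitaryUnits 𝔸), 0 < α → M * α ≤ a₀ →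
      (bg (mem M (ι jj) (ι jj).k)).Reg335 c35 α (ιCfg M (ι jj) (ι jj).k V hV) →
      B9.Ineq342_346_347 (GA (mem M (ι jj) (ι jj).k)) B₀ δ₀ (ιCfg M (ι jj) (ι jj).k V hV) ∧
        B9.Ineq343_345 (GA (mem M (ι jj) (ι jj).k)) Bβ Bε Bεβ δ₀ (ιCfg M (ι jj) (ι jj).k V hV) := by
    intro α V hV hα hMa hreg
    have hMi : M₁ ≤ (geo (mem M (ι jj) (ι jj).k)).M := by rw [(hdict M jj (ι jj).k).1]; exact hMM₁
    have hMa' : (geo (mem M (ι jj) (ι jj).k)).M * α ≤ a₀ := by rw [(hdict M jj (ι jj).k).1]; exact hMa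
    exact H (mem M (ι jj) (ι jj).k) hMi α hα hMa' (ιCfg M (ι jj) (ι jj).k V hV) hreg
  obtain ⟨r1, r2, r3, r4, r5⟩ := sockSrc_core_at_univ' geo bg GA L mem ιCfg ιLoc ops hL hM1 (ι jj) (hΩJ jj) (ι jj).k
    (hdict M jj _) (hP6 M jj _ hMM₃) (hinv M jj _ hMM₃) (hcurv M jj _ hMM₃) (havg M jj _) (hhol M jj _) (hadd M jj _)
    (hsrc M jj _ hMM₃) (hsrcH M jj _ hMM₃) hK₆ hc69 hq hcS hcSβ hB₀ h33U α₀ α₂ hα₀ hα₀c hα₂ hα₂16 U₀ hU₀ hInA A'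
    (fun j hj y τ hs => (h41 j hj y τ hs).2) hA0 f hfB hcl
  rw [← hB'_def] at r1 r2 r3 r4
  -- the source allowance: 2c_S|f|₍₋₂₎ ≤ γ″B₀′(α₀ + α₁), (C_βc_S∕B₀ + c_Sβ)|f|₍₋₂₎ ≤ γβ(α₀ + α₁)
  obtain ⟨F, hF_def⟩ : ∃ F : ℝ, F = msup L (ι jj).k (ι jj).η (-(2 : ℝ)) (fun j (x : Site d) => x ∈ (ι jj).Ω j) f := ⟨_, rfl⟩
  rw [← hF_def] at r1 r2 r4 r5 hfF
  have hF0 : 0 ≤ F := by rw [hF_def]; exact B8ScaledSupNorm.msup_nonneg L _ hη.le _ _ _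
  have hS : 2 * (cS * F) ≤ 2 * cS * γ₈ / B' * B' * (α₀ + α₁) := by
    have h1 : cS * F ≤ cS * (γ₈ * (α₀ + α₁)) := mul_le_mul_of_nonneg_left hfF.le hcS
    have h2 : 2 * cS * γ₈ / B' * B' * (α₀ + α₁) = 2 * (cS * (γ₈ * (α₀ + α₁))) := by field_simp
    linarith
  have hSβ : max 0 (CH * Bβ β) * (cS * F) / B₀ + cSβ * F ≤ (max 0 (CH * Bβ β) * cS / B₀ + cSβ) * γ₈ * (α₀ + α₁) := by
    have h1 : cS * F ≤ cS * (γ₈ * (α₀ + α₁)) := mul_le_mul_of_nonneg_left hfF.le hcS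
    have h2 : max 0 (CH * Bβ β) * (cS * F) / B₀ ≤ max 0 (CH * Bβ β) * (cS * (γ₈ * (α₀ + α₁))) / B₀ :=
      div_le_div_of_nonneg_right (mul_le_mul_of_nonneg_left h1 hCβ0) hB₀.le
    have h3 : cSβ * F ≤ cSβ * (γ₈ * (α₀ + α₁)) := mul_le_mul_of_nonneg_left hfF.le hcSβ
    have h4 : (max 0 (CH * Bβ β) * cS / B₀ + cSβ) * γ₈ * (α₀ + α₁) =
        max 0 (CH * Bβ β) * (cS * (γ₈ * (α₀ + α₁))) / B₀ + cSβ * (γ₈ * (α₀ + α₁)) := by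
      field_simp
    linarith
  have hnn : 2 * (cS * F) ≤ 2 * cS * γ₈ / B' * B' * (α₀ + α₁) := hS
  exact ⟨r1.trans (by linarith), r2.trans (by linarith), r3.trans (le_add_of_nonneg_right (by linarith [mul_nonneg hcS hF0])),
    r4.trans (by linarith), r5.trans (by linarith)⟩

/-- **(EXPLICIT CONSTANTS.)  THE `SH59src` BODY OF THE N05 RECORD KNIT AT THE `Ω₀ = ℤᵈ` MEMBERS, FROM THEOREM 3.3's `G(U)`-BLOCK AT NAMED CONSTANTS** —
`B9SupplySockB9P3ZdAtFamilies.sockH59src_of_thm33_univ_on` with the existential opened by the caller: for the consumer's `B₈ > 0`, `B₀″ ≥ 0`, `γ₈`, the two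
(1.59) lines at every truncation level `m` with B₀′ = max{1, 2B₀max{1,q}}, threshold c59 = min cP (cP∕K₀), K₀ = 2L·5dLB₈ + 8·8B₀″·5dLB₈, γ′ = 2c_Sγ₈∕B₀′
— the SAME B₀′ as `sockB9P3_allLevels_univ_explicit_on` ∕ `sockB9P3srcH_univ_explicit_on` (one opening of Theorem 3.3).
[cite: Balaban1985RegularSpaces, Thm 8 + (1.146) p.101, Thm 4 p.88, (1.59) p.86, (1.69) p.88; Balaban1985BackgroundPropagators, Thm 3.3 p.399] -/
theorem sockH59src_univ_explicit_on (hd2 : 2 ≤ d) (hL : 1 ≤ L) {c35 c₆ K₆ M₃ a₃ c69 q CH β cS cSβ : ℝ} {len : Site d → ℝ}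
    {M₁ δ₀ a₀ B₀ : ℝ} {Bβ Bε : ℝ → ℝ} {Bεβ : ℝ → ℝ → ℝ} (hB₀ : 0 < B₀)
    (H : ∀ i : I, M₁ ≤ (geo i).M → ∀ α₀ : ℝ, 0 < α₀ → (geo i).M * α₀ ≤ a₀ →
      ∀ U : (bg i).Cfg, (bg i).Reg335 c35 α₀ U →
        B9.Ineq342_346_347 (GA i) B₀ δ₀ U ∧ B9.Ineq343_345 (GA i) Bβ Bε Bεβ δ₀ U)
    {M : ℝ} (hM1 : 1 ≤ M) (hMM₁ : M₁ ≤ M) (hMM₃ : M₃ ≤ M)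
    {J : Type*} (ι : J → ZdIdx d L) (hΩJ : ∀ j, (ι j).Ω 0 = Set.univ)
    (hdict : ∀ (M : ℝ) (j : J) (m : ℕ), DictAt geo bg GA L mem ιCfg ιLoc ops M (ι j) m)
    (hP6 : ∀ (M : ℝ) (j : J) (m : ℕ), M₃ ≤ M → Prop6At bg L mem ιCfg c35 c₆ K₆ M (ι j) m)
    (hinv : ∀ (M : ℝ) (j : J) (m : ℕ), M₃ ≤ M → InvAt bg L mem ιCfg ops c35 a₃ M (ι j) m)
    (hcurv : ∀ (M : ℝ) (j : J) (m : ℕ), M₃ ≤ M → CurvAt bg L mem ιCfg ops c35 a₃ c69 M (ι j) m)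
    (havg : ∀ (M : ℝ) (j : J) (m : ℕ), AvgAt L ops q M (ι j) m)
    (hhol : ∀ (M : ℝ) (j : J) (m : ℕ), HolderAt geo bg GA L mem ιCfg ops β len CH M (ι j) m)
    (hadd : ∀ (M : ℝ) (j : J) (m : ℕ), GopAddAt L ops M (ι j) m)
    (hsrc : ∀ (M : ℝ) (j : J) (m : ℕ), M₃ ≤ M → SrcAt bg L mem ιCfg ops c35 a₃ cS M (ι j) m)
    (hsrcH : ∀ (M : ℝ) (j : J) (m : ℕ), M₃ ≤ M → SrcHolderAt bg L mem ιCfg ops c35 a₃ β len cSβ M (ι j) m)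
    (hK₆ : 0 < K₆) (hc69 : 0 ≤ c69) (hq : 0 ≤ q) (hcS : 0 ≤ cS) (hcSβ : 0 ≤ cSβ)
    (γ₈ : ℝ) {B₈ B₀'' : ℝ} (hB₈ : 0 < B₈) (hB₀'' : 0 ≤ B₀'') :
    ∀ jj : J,
      ∀ α₀ α₁ : ℝ, 0 < α₀ → 0 < α₁ → α₀ + α₁ ≤ min (min (1 / 16) (min (c₆ / M) (min (a₀ / (K₆ * M)) (min (a₃ / (K₆ * M)) (1 / (2 * B₀ * c69 * K₆ * M + 1)))))) ((min (1 / 16) (min (c₆ / M) (min (a₀ / (K₆ * M)) (min (a₃ / (K₆ * M)) (1 / (2 * B₀ * c69 * K₆ * M + 1)))))) / (2 * (L * (5 * (d : ℝ) * L * B₈)) + 8 * (8 * B₀'' * (5 * (d : ℝ) * L * B₈)))) →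
      ∀ U₀ U' : Site d → Fin d → 𝔸ˣ, (∀ x κ, U₀ x κ ∈ unitaryUnits 𝔸) → (∀ x κ, U' x κ ∈ unitaryUnits 𝔸) →
      ∀ φ : Site d → 𝔸, ((InR138 L (ι jj).k (ι jj).η ((ι jj).Ω 0) ((ι jj).Λs (ι jj).k) U₀ φ ∧ (∀ x, IsSelfAdjoint (φ x)) ∧
          (∀ x, x ∉ (ι jj).Ω 0 → φ x = 0) ∧ Bdd L (ι jj).k (ι jj).η (-(2 : ℝ)) (fun j (x : Site d) => x ∈ (ι jj).Ω j) φ) ∧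
        msup L (ι jj).k (ι jj).η (-(2 : ℝ)) (fun j (x : Site d) => x ∈ (ι jj).Ω j) φ < γ₈ * (α₀ + α₁)) →
      InAk L (ι jj).k (ι jj).η α₀ (ι jj).Ω U₀ → InAk L (ι jj).k (ι jj).η α₀ (ι jj).Ω (mulCfg U' U₀) →
      (∀ m, m ≤ (ι jj).k → InAx L m ((ι jj).Λs m) U₀ (mulCfg U' U₀)) →
      (∀ j, j ≤ (ι jj).k → ∀ (z : Site d) (μ : Fin d), (∀ x, InBox (loK L j z) (bondHiK L j z μ) x → x ∈ (ι jj).Ω j) →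
        ‖(avgIter L (mulCfg U' U₀) j z μ : 𝔸) - (avgIter L U₀ j z μ : 𝔸)‖ ≤ α₁) →
      (∀ b ∈ {b : Site d × Fin d | SideTouches ((ι jj).Ω 0) b.1 b.2}, ‖((U' b.1 b.2 : 𝔸ˣ) : 𝔸) - 1‖ ≤ α₁) →
      (∀ m, 1 ≤ m → m ≤ (ι jj).k → ∀ (u : Site d → 𝔸ˣ) (W : Site d → Fin d → 𝔸ˣ) (A' : Site d → Fin d → 𝔸),
        (∀ x, u x ∈ unitaryUnits 𝔸) → mgauge U₀ u W = U' → Restr129 L m ((ι jj).Λs m) U₀ u →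
        LanF146 L (ι jj).k (ι jj).η ((ι jj).Ω 0) (ι jj).Λs U₀ φ m W →
        (∀ y τ, IsSelfAdjoint (A' y τ)) →
        (∀ j, j ≤ m → ∀ y τ, SideTouches ((ι jj).Ω j) y τ →
        W y τ = cfgExp (ι jj).η A' y τ ∧ ‖A' y τ‖ ≤ (2 * (L * (5 * (d : ℝ) * L * B₈ * (α₀ + α₁))) + 8 * (8 * B₀'' * (5 * (d : ℝ) * L * B₈) * (α₀ + α₁))) * ((L : ℝ) ^ j * (ι jj).η)⁻¹) →
        (∀ y τ, (∀ j, j ≤ m → ¬ SideTouches ((ι jj).Ω j) y τ) → A' y τ = 0) →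
        msup L m (ι jj).η (-(1 : ℝ)) (fun j (b : Site d × Fin d) => SideTouches ((ι jj).Ω j) b.1 b.2) (fun b => A' b.1 b.2)
        ≤ (max 1 (2 * B₀ * max 1 q)) * (bondNorm L m (ι jj).η (-(3 : ℝ)) (ι jj).Ω (fun x μ => Jcur (ι jj).η U₀ A' μ x)
        + wsup 1 (fun p : {p : ℕ × (Site d × Fin d) // p.1 ≤ m ∧ p.2 ∈ (ι jj).Λb m p.1} =>
        linCovIter L U₀ (iEta (ι jj).η A') p.1.1 p.1.2.1 p.1.2.2)) + (2 * cS * γ₈ / max 1 (2 * B₀ * max 1 q)) * (max 1 (2 * B₀ * max 1 q)) * (α₀ + α₁) ∧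
        msup L m (ι jj).η (-(2 : ℝ)) (fun j (t : Fin d × Fin d × Site d) => SideTouches ((ι jj).Ω j) t.2.2 t.2.1)
        (fun t => covDerivFwd (ι jj).η U₀ t.1 (fun z => A' z t.2.1) t.2.2)
        ≤ (max 1 (2 * B₀ * max 1 q)) * (bondNorm L m (ι jj).η (-(3 : ℝ)) (ι jj).Ω (fun x μ => Jcur (ι jj).η U₀ A' μ x)
        + wsup 1 (fun p : {p : ℕ × (Site d × Fin d) // p.1 ≤ m ∧ p.2 ∈ (ι jj).Λb m p.1} =>
        linCovIter L U₀ (iEta (ι jj).η A') p.1.1 p.1.2.1 p.1.2.2)) + (2 * cS * γ₈ / max 1 (2 * B₀ * max 1 q)) * (max 1 (2 * B₀ * max 1 q)) * (α₀ + α₁)) := by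
  have hM0 : 0 < M := lt_of_lt_of_le one_pos hM1
  have hKM : 0 < K₆ * M := mul_pos hK₆ hM0
  have hL' : (1 : ℝ) ≤ L := by exact_mod_cast hL
  have hd' : (1 : ℝ) ≤ d := by exact_mod_cast (le_trans (by norm_num) hd2 : 1 ≤ d)
  obtain ⟨B', hB'_def⟩ : ∃ B' : ℝ, B' = max 1 (2 * B₀ * max 1 q) := ⟨_, rfl⟩
  have hB'1 : 1 ≤ B' := by rw [hB'_def]; exact le_max_left _ _
  have hB'0 : 0 < B' := lt_of_lt_of_le one_pos hB'1
  obtain ⟨cP, hcP_def⟩ : ∃ cP : ℝ,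
      cP = min (1 / 16) (min (c₆ / M) (min (a₀ / (K₆ * M)) (min (a₃ / (K₆ * M)) (1 / (2 * B₀ * c69 * K₆ * M + 1))))) := ⟨_, rfl⟩
  set K₀ : ℝ := (2 * (L * (5 * (d : ℝ) * L * B₈)) + 8 * (8 * B₀'' * (5 * (d : ℝ) * L * B₈))) with hK₀_def
  have hK₀ : 0 < K₀ := by
    have h1 : 0 < 2 * (L * (5 * (d : ℝ) * L * B₈)) := by positivity
    have h2 : 0 ≤ 8 * (8 * B₀'' * (5 * (d : ℝ) * L * B₈)) := by positivity
    linarith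
  rw [← hB'_def, ← hcP_def]
  intro jj α₀ α₁ hα₀ hα₁ hs U₀ U' hU₀ hU' φ hφ hInA _ _ _ _ m _ hmk u W A' hu hW _ hLanF _ h41 hA0
  obtain ⟨⟨-, -, -, hφB⟩, hφF⟩ := hφ
  have hη : 0 < (ι jj).η := (ι jj).hη
  -- the smallness constant of the datum and the guard of the level-`m` socket
  set K : ℝ := 2 * (L * (5 * (d : ℝ) * L * B₈ * (α₀ + α₁))) + 8 * (8 * B₀'' * (5 * (d : ℝ) * L * B₈) * (α₀ + α₁)) with hK_def
  have hKK₀ : K = K₀ * (α₀ + α₁) := by rw [hK_def, hK₀_def]; ring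
  have hS0 : 0 < α₀ + α₁ := add_pos hα₀ hα₁
  have hKpos : 0 < K := by rw [hKK₀]; exact mul_pos hK₀ hS0
  have hα₀P : α₀ ≤ cP := by linarith only [hα₁, hs, min_le_left cP (cP / K₀)]
  have hKP : K ≤ cP := by
    have h1 : α₀ + α₁ ≤ cP / K₀ := hs.trans (min_le_right _ _)
    calc K = K₀ * (α₀ + α₁) := hKK₀
      _ ≤ K₀ * (cP / K₀) := mul_le_mul_of_nonneg_left h1 hK₀.le
      _ = cP := by field_simp
  have hK16 : K ≤ 1 / 16 := hKP.trans (by rw [hcP_def]; exact min_le_left _ _)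
  rw [hcP_def] at hα₀P
  -- the datum is a datum of the sourced core at level `m`
  have hWu : ∀ x κ, W x κ ∈ unitaryUnits 𝔸 := mem_unitaryUnits_of_mgauge_eq hU₀ hU' hu hW
  have hInAm : InAk L m (ι jj).η α₀ (ι jj).Ω U₀ := fun j hj => hInA j (hj.trans hmk)
  have hlog : ∀ (x : Site d) (μ : Fin d), BondTouches ((ι jj).Ω 0) x μ → logCfg (ι jj).η W x μ = A' x μ :=
    fun x μ _ => B9SupplySockB9P3ZdSrc.logCfg_eq_of_univ L hd2 hη (hΩJ jj) U₀ hWu hK16 h41 x μ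
  have hcl : ∃ μ : ℕ → Site d → 𝔸, ∀ x ∈ (ι jj).Ω 0,
      covLap (ι jj).η U₀ (((ι jj).Ω 0).indicator (covDivB (ι jj).η U₀ A' - φ)) x = QT L m ((ι jj).Λs m) U₀ μ x :=
    (B9SupplySockB9P3ZdSrc.mulClause_congr φ hlog).1 hLanF.1
  have h33U : ∀ (α : ℝ) (V : Site d → Fin d → 𝔸ˣ) (hV : ∀ x κ, V x κ ∈ unitaryUnits 𝔸), 0 < α → M * α ≤ a₀ →
      (bg (mem M (ι jj) m)).Reg335 c35 α (ιCfg M (ι jj) m V hV) →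
      B9.Ineq342_346_347 (GA (mem M (ι jj) m)) B₀ δ₀ (ιCfg M (ι jj) m V hV) ∧
        B9.Ineq343_345 (GA (mem M (ι jj) m)) Bβ Bε Bεβ δ₀ (ιCfg M (ι jj) m V hV) := by
    intro α V hV hα hMa hreg
    have hMi : M₁ ≤ (geo (mem M (ι jj) m)).M := by rw [(hdict M jj m).1]; exact hMM₁
    have hMa' : (geo (mem M (ι jj) m)).M * α ≤ a₀ := by rw [(hdict M jj m).1]; exact hMa
    exact H (mem M (ι jj) m) hMi α hα hMa' (ιCfg M (ι jj) m V hV) hreg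
  obtain ⟨r1, r2, -, -, -⟩ := sockSrc_core_at_univ' geo bg GA L mem ιCfg ιLoc ops hL hM1 (ι jj) (hΩJ jj) m
    (hdict M jj _) (hP6 M jj _ hMM₃) (hinv M jj _ hMM₃) (hcurv M jj _ hMM₃) (havg M jj _) (hhol M jj _) (hadd M jj _)
    (hsrc M jj _ hMM₃) (hsrcH M jj _ hMM₃) hK₆ hc69 hq hcS hcSβ hB₀ h33U α₀ K hα₀ hα₀P hKpos hK16 U₀ hU₀ hInAm A'
    (fun j hj y τ hs' => (h41 j hj y τ hs').2) hA0 φ hφB hcl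
  rw [← hB'_def] at r1 r2
  obtain ⟨F, hF_def⟩ : ∃ F : ℝ, F = msup L (ι jj).k (ι jj).η (-(2 : ℝ)) (fun j (x : Site d) => x ∈ (ι jj).Ω j) φ := ⟨_, rfl⟩
  rw [← hF_def] at r1 r2 hφF
  have hS : 2 * (cS * F) ≤ 2 * cS * γ₈ / B' * B' * (α₀ + α₁) := by
    have h1 : cS * F ≤ cS * (γ₈ * (α₀ + α₁)) := mul_le_mul_of_nonneg_left hφF.le hcS
    have h2 : 2 * cS * γ₈ / B' * B' * (α₀ + α₁) = 2 * (cS * (γ₈ * (α₀ + α₁))) := by field_simp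
    linarith
  exact ⟨r1.trans (by linarith), r2.trans (by linarith)⟩

/-! ## §2 The JOINT ∃-packagings: ONE opening of Theorem 3.3, ONE constant tuple for every socket a knit consumes -/

/-- ★★ **THE ONE-B₀ SUPPLIER FOR THE N05 RECORD KNIT (dag-n05-d `…N05SubBHKnitUnivT8Srv`, p521275): `SB9all` ∧ `SB9srcH` ∧ `SH59src` FROM [4] THEOREM 3.3 BY NAME WITH A
SINGLE CONSTANT TUPLE.**  `B9.Thm33Printed c35 geo bg Gp GA` + the At-binders over an index map `ι : J → ZdIdx d L` of `Ω₀ = ℤᵈ` members (`DictAt`, `Prop6At`,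
`InvAt`, `CurvAt`, `LandauAt`, `AvgAt`, `HolderAt`, `GopAddAt`, `SrcAt`, `SrcHolderAt`) give, for the consumer's `γ₈ ≥ 0`, ONE tuple `(B₀′, B₀β′, cP, γ′, γβ)`
with: (i) `SockB9P3 L B₀′ B₀β′ cP …` at every `ι j`, every `m ≤ k` (the `SB9all` binder, `λ.inp.B₀ := B₀′`, `λ.B₀β := B₀β′`); (ii) the `SB9srcH` body at
`(B₀′, B₀β′, cP, γ″ := γ′, γβ)`; (iii) for EVERY `B₈ > 0`, `B₀″ ≥ 0` the consumer fixes afterwards (its `B₈ ≥ λ.inp.B₀ + …`, `λ.inp.B₀′`), a threshold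
`0 < c59 ≤ cP` with the `SH59src` body at `(B₀′, B₈, B₀″, c59, γ′)` — answering ref-A READ-11's KNIT-NOTE (the three landed suppliers quantify their constants
separately; the record knit takes ONE `λ.inp.B₀`).  B₀′ = max{1, 2B₀max{1,q}}, B₀β′ = 2max{0, C_H Bβ(β)}max{1,q}, cP = min{1∕16, c₆∕M, a₀∕(K₆M), a₃∕(K₆M),
1∕(2B₀c₆₉K₆M+1)} at M = max{1, M₁, M₃}, γ′ = 2c_Sγ₈∕B₀′, γβ = (max{0, C_H Bβ(β)}c_S∕B₀ + c_Sβ)γ₈, c59 = min cP (cP∕K₀).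
[cite: Balaban1985RegularSpaces, (1.58)–(1.59) p.86, Prop. 3 p.87, Thm 4 p.88, Thm 8 + (1.146) p.101; Balaban1985BackgroundPropagators, Thm 3.3 p.399, (3.27) p.395] -/
theorem sockUniv_joint_of_thm33_on (hd2 : 2 ≤ d) (hL : 1 ≤ L) {c35 c₆ K₆ M₃ a₃ c69 q CH β cS cSβ : ℝ} {len : Site d → ℝ}
    {Gp : ∀ i, B9.KernelFamily (geo i) (bg i)} (h33 : B9.Thm33Printed c35 geo bg Gp GA)
    {J : Type*} (ι : J → ZdIdx d L) (hΩJ : ∀ j, (ι j).Ω 0 = Set.univ)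
    (hdict : ∀ (M : ℝ) (j : J) (m : ℕ), DictAt geo bg GA L mem ιCfg ιLoc ops M (ι j) m)
    (hP6 : ∀ (M : ℝ) (j : J) (m : ℕ), M₃ ≤ M → Prop6At bg L mem ιCfg c35 c₆ K₆ M (ι j) m)
    (hinv : ∀ (M : ℝ) (j : J) (m : ℕ), M₃ ≤ M → InvAt bg L mem ιCfg ops c35 a₃ M (ι j) m)
    (hcurv : ∀ (M : ℝ) (j : J) (m : ℕ), M₃ ≤ M → CurvAt bg L mem ιCfg ops c35 a₃ c69 M (ι j) m)
    (hlan : ∀ (M : ℝ) (j : J) (m : ℕ), M₃ ≤ M → LandauAt bg L mem ιCfg ops c35 a₃ M (ι j) m)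
    (havg : ∀ (M : ℝ) (j : J) (m : ℕ), AvgAt L ops q M (ι j) m)
    (hhol : ∀ (M : ℝ) (j : J) (m : ℕ), HolderAt geo bg GA L mem ιCfg ops β len CH M (ι j) m)
    (hadd : ∀ (M : ℝ) (j : J) (m : ℕ), GopAddAt L ops M (ι j) m)
    (hsrc : ∀ (M : ℝ) (j : J) (m : ℕ), M₃ ≤ M → SrcAt bg L mem ιCfg ops c35 a₃ cS M (ι j) m)
    (hsrcH : ∀ (M : ℝ) (j : J) (m : ℕ), M₃ ≤ M → SrcHolderAt bg L mem ιCfg ops c35 a₃ β len cSβ M (ι j) m)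
    (hc₆ : 0 < c₆) (hK₆ : 0 < K₆) (ha₃ : 0 < a₃) (hc69 : 0 ≤ c69) (hq : 0 ≤ q) (hcS : 0 ≤ cS) (hcSβ : 0 ≤ cSβ)
    {γ₈ : ℝ} (hγ₈ : 0 ≤ γ₈) :
    ∃ B₀' B₀β cP γ' γβ : ℝ, 0 < B₀' ∧ 0 ≤ B₀β ∧ 0 < cP ∧ 0 ≤ γ' ∧ 0 ≤ γβ ∧
      (∀ (j : J) (m : ℕ), m ≤ (ι j).k → SockB9P3 (𝔸 := 𝔸) L B₀' B₀β cP β len (ι j).η m (ι j).Ω (ι j).Λs (ι j).Λb) ∧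
      (∀ jj : J,
      ∀ α₀ α₁ α₂ : ℝ, 0 < α₀ → α₀ ≤ cP → 0 < α₁ → 0 < α₂ → α₂ ≤ cP →
      ∀ (U₀ W : Site d → Fin d → 𝔸ˣ), (∀ x κ, U₀ x κ ∈ unitaryUnits 𝔸) → (∀ x κ, W x κ ∈ unitaryUnits 𝔸) →
      ∀ f : Site d → 𝔸, InR138 L (ι jj).k (ι jj).η ((ι jj).Ω 0) ((ι jj).Λs (ι jj).k) U₀ f →
      (∀ x, IsSelfAdjoint (f x)) → (∀ x, x ∉ (ι jj).Ω 0 → f x = 0) →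
      Bdd L (ι jj).k (ι jj).η (-(2 : ℝ)) (fun j (x : Site d) => x ∈ (ι jj).Ω j) f →
      msup L (ι jj).k (ι jj).η (-(2 : ℝ)) (fun j (x : Site d) => x ∈ (ι jj).Ω j) f < γ₈ * (α₀ + α₁) →
      msup L (ι jj).k (ι jj).η (-(3 : ℝ)) (fun j (p : Fin d × Site d) => p.2 ∈ (ι jj).Ω j) (fun p => covDerivFwd (ι jj).η U₀ p.1 f p.2) < γ₈ * (α₀ + α₁) →
      InAk L (ι jj).k (ι jj).η α₀ (ι jj).Ω U₀ → InAk L (ι jj).k (ι jj).η α₀ (ι jj).Ω (mulCfg W U₀) →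
      IsLandau146W L (ι jj).k (ι jj).η ((ι jj).Ω 0) ((ι jj).Λs (ι jj).k) U₀ f W →
      ∀ A' : Site d → Fin d → 𝔸, (∀ y τ, IsSelfAdjoint (A' y τ)) →
      (∀ j, j ≤ (ι jj).k → ∀ (y : Site d) (τ : Fin d), SideTouches ((ι jj).Ω j) y τ →
        W y τ = cfgExp (ι jj).η A' y τ ∧ ‖A' y τ‖ ≤ α₂ * ((L : ℝ) ^ j * (ι jj).η)⁻¹) →
      (∀ (y : Site d) (τ : Fin d), (∀ j, j ≤ (ι jj).k → ¬ SideTouches ((ι jj).Ω j) y τ) → A' y τ = 0) →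
      msup L (ι jj).k (ι jj).η (-(1 : ℝ)) (fun j (b : Site d × Fin d) => SideTouches ((ι jj).Ω j) b.1 b.2) (fun b => A' b.1 b.2)
          ≤ B₀' * (bondNorm L (ι jj).k (ι jj).η (-(3 : ℝ)) (ι jj).Ω (fun x μ => Jcur (ι jj).η U₀ A' μ x)
            + wsup 1 (fun p : {p : ℕ × (Site d × Fin d) // p.1 ≤ (ι jj).k ∧ p.2 ∈ (ι jj).Λb (ι jj).k p.1} =>
                linCovIter L U₀ (iEta (ι jj).η A') p.1.1 p.1.2.1 p.1.2.2)) + γ' * B₀' * (α₀ + α₁) ∧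
        msup L (ι jj).k (ι jj).η (-(2 : ℝ)) (fun j (t : Fin d × Fin d × Site d) => SideTouches ((ι jj).Ω j) t.2.2 t.2.1)
            (fun t => covDerivFwd (ι jj).η U₀ t.1 (fun z => A' z t.2.1) t.2.2)
          ≤ B₀' * (bondNorm L (ι jj).k (ι jj).η (-(3 : ℝ)) (ι jj).Ω (fun x μ => Jcur (ι jj).η U₀ A' μ x)
            + wsup 1 (fun p : {p : ℕ × (Site d × Fin d) // p.1 ≤ (ι jj).k ∧ p.2 ∈ (ι jj).Λb (ι jj).k p.1} =>
                linCovIter L U₀ (iEta (ι jj).η A') p.1.1 p.1.2.1 p.1.2.2)) + γ' * B₀' * (α₀ + α₁) ∧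
        bondNorm L (ι jj).k (ι jj).η (-(3 : ℝ)) (ι jj).Ω (fun x μ => pdiv (ι jj).η U₀ (plaqCovDeriv (ι jj).η U₀ A') μ x)
          ≤ B₀' * (bondNorm L (ι jj).k (ι jj).η (-(3 : ℝ)) (ι jj).Ω (fun x μ => Jcur (ι jj).η U₀ A' μ x)
            + wsup 1 (fun p : {p : ℕ × (Site d × Fin d) // p.1 ≤ (ι jj).k ∧ p.2 ∈ (ι jj).Λb (ι jj).k p.1} =>
                linCovIter L U₀ (iEta (ι jj).η A') p.1.1 p.1.2.1 p.1.2.2)) + γ' * B₀' * (α₀ + α₁) ∧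
        bondNorm L (ι jj).k (ι jj).η (-(3 : ℝ)) (ι jj).Ω (fun x μ => covLap (ι jj).η U₀ (fun z => A' z μ) x)
          ≤ B₀' * (bondNorm L (ι jj).k (ι jj).η (-(3 : ℝ)) (ι jj).Ω (fun x μ => Jcur (ι jj).η U₀ A' μ x)
            + wsup 1 (fun p : {p : ℕ × (Site d × Fin d) // p.1 ≤ (ι jj).k ∧ p.2 ∈ (ι jj).Λb (ι jj).k p.1} =>
                linCovIter L U₀ (iEta (ι jj).η A') p.1.1 p.1.2.1 p.1.2.2)) + γ' * B₀' * (α₀ + α₁) ∧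
        msup L (ι jj).k (ι jj).η (-(2 + β)) (fun j (q : Fin d × Fin d × (Site d × Site d)) => q.2.2 ∈ AdmPair (ι jj).η len ∧ q.2.2.1 ∈ (ι jj).Ω j)
            (fun q => hquot (ι jj).η β len U₀ (covDerivFwd (ι jj).η U₀ q.1 (fun z => A' z q.2.1)) q.2.2)
          ≤ B₀β * (bondNorm L (ι jj).k (ι jj).η (-(3 : ℝ)) (ι jj).Ω (fun x μ => Jcur (ι jj).η U₀ A' μ x)
            + wsup 1 (fun p : {p : ℕ × (Site d × Fin d) // p.1 ≤ (ι jj).k ∧ p.2 ∈ (ι jj).Λb (ι jj).k p.1} =>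
                linCovIter L U₀ (iEta (ι jj).η A') p.1.1 p.1.2.1 p.1.2.2)) + γβ * (α₀ + α₁)) ∧
      (∀ B₈ B₀'' : ℝ, 0 < B₈ → 0 ≤ B₀'' → ∃ c59 : ℝ, 0 < c59 ∧ c59 ≤ cP ∧ ∀ jj : J,
      ∀ α₀ α₁ : ℝ, 0 < α₀ → 0 < α₁ → α₀ + α₁ ≤ c59 →
      ∀ U₀ U' : Site d → Fin d → 𝔸ˣ, (∀ x κ, U₀ x κ ∈ unitaryUnits 𝔸) → (∀ x κ, U' x κ ∈ unitaryUnits 𝔸) →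
      ∀ φ : Site d → 𝔸, ((InR138 L (ι jj).k (ι jj).η ((ι jj).Ω 0) ((ι jj).Λs (ι jj).k) U₀ φ ∧ (∀ x, IsSelfAdjoint (φ x)) ∧
          (∀ x, x ∉ (ι jj).Ω 0 → φ x = 0) ∧ Bdd L (ι jj).k (ι jj).η (-(2 : ℝ)) (fun j (x : Site d) => x ∈ (ι jj).Ω j) φ) ∧
        msup L (ι jj).k (ι jj).η (-(2 : ℝ)) (fun j (x : Site d) => x ∈ (ι jj).Ω j) φ < γ₈ * (α₀ + α₁)) →
      InAk L (ι jj).k (ι jj).η α₀ (ι jj).Ω U₀ → InAk L (ι jj).k (ι jj).η α₀ (ι jj).Ω (mulCfg U' U₀) →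
      (∀ m, m ≤ (ι jj).k → InAx L m ((ι jj).Λs m) U₀ (mulCfg U' U₀)) →
      (∀ j, j ≤ (ι jj).k → ∀ (z : Site d) (μ : Fin d), (∀ x, InBox (loK L j z) (bondHiK L j z μ) x → x ∈ (ι jj).Ω j) →
        ‖(avgIter L (mulCfg U' U₀) j z μ : 𝔸) - (avgIter L U₀ j z μ : 𝔸)‖ ≤ α₁) →
      (∀ b ∈ {b : Site d × Fin d | SideTouches ((ι jj).Ω 0) b.1 b.2}, ‖((U' b.1 b.2 : 𝔸ˣ) : 𝔸) - 1‖ ≤ α₁) →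
      (∀ m, 1 ≤ m → m ≤ (ι jj).k → ∀ (u : Site d → 𝔸ˣ) (W : Site d → Fin d → 𝔸ˣ) (A' : Site d → Fin d → 𝔸),
        (∀ x, u x ∈ unitaryUnits 𝔸) → mgauge U₀ u W = U' → Restr129 L m ((ι jj).Λs m) U₀ u →
        LanF146 L (ι jj).k (ι jj).η ((ι jj).Ω 0) (ι jj).Λs U₀ φ m W →
        (∀ y τ, IsSelfAdjoint (A' y τ)) →
        (∀ j, j ≤ m → ∀ y τ, SideTouches ((ι jj).Ω j) y τ →
        W y τ = cfgExp (ι jj).η A' y τ ∧ ‖A' y τ‖ ≤ (2 * (L * (5 * (d : ℝ) * L * B₈ * (α₀ + α₁))) + 8 * (8 * B₀'' * (5 * (d : ℝ) * L * B₈) * (α₀ + α₁))) * ((L : ℝ) ^ j * (ι jj).η)⁻¹) →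
        (∀ y τ, (∀ j, j ≤ m → ¬ SideTouches ((ι jj).Ω j) y τ) → A' y τ = 0) →
        msup L m (ι jj).η (-(1 : ℝ)) (fun j (b : Site d × Fin d) => SideTouches ((ι jj).Ω j) b.1 b.2) (fun b => A' b.1 b.2)
        ≤ B₀' * (bondNorm L m (ι jj).η (-(3 : ℝ)) (ι jj).Ω (fun x μ => Jcur (ι jj).η U₀ A' μ x)
        + wsup 1 (fun p : {p : ℕ × (Site d × Fin d) // p.1 ≤ m ∧ p.2 ∈ (ι jj).Λb m p.1} =>
        linCovIter L U₀ (iEta (ι jj).η A') p.1.1 p.1.2.1 p.1.2.2)) + γ' * B₀' * (α₀ + α₁) ∧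
        msup L m (ι jj).η (-(2 : ℝ)) (fun j (t : Fin d × Fin d × Site d) => SideTouches ((ι jj).Ω j) t.2.2 t.2.1)
        (fun t => covDerivFwd (ι jj).η U₀ t.1 (fun z => A' z t.2.1) t.2.2)
        ≤ B₀' * (bondNorm L m (ι jj).η (-(3 : ℝ)) (ι jj).Ω (fun x μ => Jcur (ι jj).η U₀ A' μ x)
        + wsup 1 (fun p : {p : ℕ × (Site d × Fin d) // p.1 ≤ m ∧ p.2 ∈ (ι jj).Λb m p.1} =>
        linCovIter L U₀ (iEta (ι jj).η A') p.1.1 p.1.2.1 p.1.2.2)) + γ' * B₀' * (α₀ + α₁))) := by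
  obtain ⟨M₁, δ₀, a₀, B₀, Bβ, Bε, Bεβ, -, -, ha₀, hB₀, H⟩ := h33
  have H' : ∀ i : I, M₁ ≤ (geo i).M → ∀ α₀ : ℝ, 0 < α₀ → (geo i).M * α₀ ≤ a₀ →
      ∀ U : (bg i).Cfg, (bg i).Reg335 c35 α₀ U →
        B9.Ineq342_346_347 (GA i) B₀ δ₀ U ∧ B9.Ineq343_345 (GA i) Bβ Bε Bεβ δ₀ U :=
    fun i hMi α₀ hα₀ hMa U hreg => (H i hMi α₀ hα₀ hMa U hreg).2
  obtain ⟨M, hM_def⟩ : ∃ M : ℝ, M = max 1 (max M₁ M₃) := ⟨_, rfl⟩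
  have hM1 : 1 ≤ M := by rw [hM_def]; exact le_max_left _ _
  have hMM₁ : M₁ ≤ M := by rw [hM_def]; exact (le_max_left _ _).trans (le_max_right _ _)
  have hMM₃ : M₃ ≤ M := by rw [hM_def]; exact (le_max_right _ _).trans (le_max_right _ _)
  have hM0 : 0 < M := lt_of_lt_of_le one_pos hM1
  have hKM : 0 < K₆ * M := mul_pos hK₆ hM0
  have hB'0 : 0 < max 1 (2 * B₀ * max 1 q) := lt_of_lt_of_le one_pos (le_max_left _ _)
  have hcP : 0 < min (1 / 16) (min (c₆ / M) (min (a₀ / (K₆ * M)) (min (a₃ / (K₆ * M)) (1 / (2 * B₀ * c69 * K₆ * M + 1))))) := by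
    refine lt_min (by norm_num) (lt_min (div_pos hc₆ hM0) (lt_min (div_pos ha₀ hKM) (lt_min (div_pos ha₃ hKM) ?_)))
    have : 0 < 2 * B₀ * c69 * K₆ * M + 1 := by positivity
    positivity
  have hL' : (1 : ℝ) ≤ L := by exact_mod_cast hL
  have hd' : (1 : ℝ) ≤ d := by exact_mod_cast (le_trans (by norm_num) hd2 : 1 ≤ d)
  refine ⟨max 1 (2 * B₀ * max 1 q), 2 * max 0 (CH * Bβ β) * max 1 q,
    min (1 / 16) (min (c₆ / M) (min (a₀ / (K₆ * M)) (min (a₃ / (K₆ * M)) (1 / (2 * B₀ * c69 * K₆ * M + 1))))),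
    2 * cS * γ₈ / max 1 (2 * B₀ * max 1 q), (max 0 (CH * Bβ β) * cS / B₀ + cSβ) * γ₈, hB'0, by positivity, hcP, by positivity, by positivity,
    sockB9P3_allLevels_univ_explicit_on geo bg GA L mem ιCfg ιLoc ops hd2 hL hB₀ H' hM1 hMM₁ hMM₃ ι hΩJ hdict hP6 hinv hcurv hlan havg hhol hK₆ hc69 hq,
    sockB9P3srcH_univ_explicit_on geo bg GA L mem ιCfg ιLoc ops hd2 hL hB₀ H' hM1 hMM₁ hMM₃ ι hΩJ hdict hP6 hinv hcurv havg hhol hadd hsrc hsrcH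
      hK₆ hc69 hq hcS hcSβ γ₈,
    fun B₈ B₀'' hB₈ hB₀'' => ?_⟩
  have hK₀ : 0 < (2 * (L * (5 * (d : ℝ) * L * B₈)) + 8 * (8 * B₀'' * (5 * (d : ℝ) * L * B₈))) := by
    have h1 : 0 < 2 * (L * (5 * (d : ℝ) * L * B₈)) := by positivity
    have h2 : 0 ≤ 8 * (8 * B₀'' * (5 * (d : ℝ) * L * B₈)) := by positivity
    linarith
  exact ⟨_, lt_min hcP (div_pos hcP hK₀), min_le_left _ _,
    sockH59src_univ_explicit_on geo bg GA L mem ιCfg ιLoc ops hd2 hL hB₀ H' hM1 hMM₁ hMM₃ ι hΩJ hdict hP6 hinv hcurv havg hhol hadd hsrc hsrcH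
      hK₆ hc69 hq hcS hcSβ γ₈ hB₈ hB₀''⟩

end Supply

/-! ## §3 The cube subtype of (1.131): the four-line collar family and dag-n05-e's `SH59D` from ONE B₀′ -/

section Bridge

/-- **(EXPLICIT CONSTANTS.)  dag-n05-e's `SH59D` BINDER OVER THE CUBE SUBTYPE OF (1.131), FROM THEOREM 3.3's `G(U)`-BLOCK AT NAMED CONSTANTS** —
`B9SupplySockB9P3ZdAtFamilies.sh59D_cubeSubfamily_of_thm33_on` with the existential opened by the caller: for any `B₀″ ≥ 0`, the binder holds at
`(B₀, B₀′, Bbd, cP) := (B₀′, B₀″, (20d+2)B₀′, c59)`, B₀′ = max{1, 2B₀max{1,q}}, c59 = min cP (cP∕K₀), K₀ = 2L·5dLB₀′ + 8·8B₀″·5dLB₀′, cP at M = any block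
parameter `≥ max{1, M₁, M₃}` — the SAME B₀′, cP as `sockB9P3D4_allLevels_explicit_on` (one opening of Theorem 3.3; the cube families have `Margin2`).
[cite: Balaban1985RegularSpaces, Thm 4 p.88, Prop. 6 p.99, (1.131)–(1.133) p.99, (1.59) p.86; Balaban1985BackgroundPropagators, Thm 3.3 p.399] -/
theorem sh59D_cube_explicit_on (hd2 : 2 ≤ d) {L : ℕ} (hL : 2 ≤ L)
    {I : Type} (geo : I → B9.Geometry) (bg : I → B9.Backgrounds) (GA : ∀ i, B9.KernelFamily (geo i) (bg i))
    (mem : ℝ → ZdIdx d L → ℕ → I)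
    (ιCfg : ∀ (M : ℝ) (i : ZdIdx d L) (m : ℕ) (U₀ : Site d → Fin d → 𝔸ˣ), (∀ x κ, U₀ x κ ∈ unitaryUnits 𝔸) → (bg (mem M i m)).Cfg)
    (ιLoc : ∀ (M : ℝ) (i : ZdIdx d L) (m : ℕ), (Site d → Fin d → 𝔸) → (geo (mem M i m)).Loc)
    (ops : ℝ → ZdIdx d L → ℕ → OpsZd d 𝔸) {c35 c₆ K₆ M₃ a₃ c69 q : ℝ}
    {M₁ δ₀ a₀ B₀ : ℝ} {Bβ Bε : ℝ → ℝ} {Bεβ : ℝ → ℝ → ℝ} (ha₀ : 0 < a₀) (hB₀ : 0 < B₀)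
    (H : ∀ i : I, M₁ ≤ (geo i).M → ∀ α₀ : ℝ, 0 < α₀ → (geo i).M * α₀ ≤ a₀ →
      ∀ U : (bg i).Cfg, (bg i).Reg335 c35 α₀ U →
        B9.Ineq342_346_347 (GA i) B₀ δ₀ U ∧ B9.Ineq343_345 (GA i) Bβ Bε Bεβ δ₀ U)
    {M : ℝ} (hM1 : 1 ≤ M) (hMM₁ : M₁ ≤ M) (hMM₃ : M₃ ≤ M)
    (hdict : ∀ (M' : ℝ) (i : {i : ZdIdx d L // ∃ (a : Site d) (M ρ : ℕ), L ≤ ρ ∧ ρ ≤ M ∧ 11 * d < M ∧ L ≤ d * M ∧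
        i.Ω = cubeFam false L a M ρ i.k ∧ i.Λs = cubeLamS L a M ρ i.k ∧ i.Λb = cubeLamB L a M ρ i.k}) (m : ℕ),
      DictAt geo bg GA L mem ιCfg ιLoc ops M' i.1 m)
    (hP6 : ∀ (M' : ℝ) (i : {i : ZdIdx d L // ∃ (a : Site d) (M ρ : ℕ), L ≤ ρ ∧ ρ ≤ M ∧ 11 * d < M ∧ L ≤ d * M ∧
        i.Ω = cubeFam false L a M ρ i.k ∧ i.Λs = cubeLamS L a M ρ i.k ∧ i.Λb = cubeLamB L a M ρ i.k}) (m : ℕ),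
      M₃ ≤ M' → Prop6At bg L mem ιCfg c35 c₆ K₆ M' i.1 m)
    (hinv : ∀ (M' : ℝ) (i : {i : ZdIdx d L // ∃ (a : Site d) (M ρ : ℕ), L ≤ ρ ∧ ρ ≤ M ∧ 11 * d < M ∧ L ≤ d * M ∧
        i.Ω = cubeFam false L a M ρ i.k ∧ i.Λs = cubeLamS L a M ρ i.k ∧ i.Λb = cubeLamB L a M ρ i.k}) (m : ℕ),
      M₃ ≤ M' → InvAt bg L mem ιCfg ops c35 a₃ M' i.1 m)
    (hcurv : ∀ (M' : ℝ) (i : {i : ZdIdx d L // ∃ (a : Site d) (M ρ : ℕ), L ≤ ρ ∧ ρ ≤ M ∧ 11 * d < M ∧ L ≤ d * M ∧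
        i.Ω = cubeFam false L a M ρ i.k ∧ i.Λs = cubeLamS L a M ρ i.k ∧ i.Λb = cubeLamB L a M ρ i.k}) (m : ℕ),
      M₃ ≤ M' → CurvAt bg L mem ιCfg ops c35 a₃ c69 M' i.1 m)
    (hlan : ∀ (M' : ℝ) (i : {i : ZdIdx d L // ∃ (a : Site d) (M ρ : ℕ), L ≤ ρ ∧ ρ ≤ M ∧ 11 * d < M ∧ L ≤ d * M ∧
        i.Ω = cubeFam false L a M ρ i.k ∧ i.Λs = cubeLamS L a M ρ i.k ∧ i.Λb = cubeLamB L a M ρ i.k}) (m : ℕ),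
      M₃ ≤ M' → LandauAt bg L mem ιCfg ops c35 a₃ M' i.1 m)
    (havg : ∀ (M' : ℝ) (i : {i : ZdIdx d L // ∃ (a : Site d) (M ρ : ℕ), L ≤ ρ ∧ ρ ≤ M ∧ 11 * d < M ∧ L ≤ d * M ∧
        i.Ω = cubeFam false L a M ρ i.k ∧ i.Λs = cubeLamS L a M ρ i.k ∧ i.Λb = cubeLamB L a M ρ i.k}) (m : ℕ),
      AvgAt L ops q M' i.1 m)
    (hc₆ : 0 < c₆) (hK₆ : 0 < K₆) (ha₃ : 0 < a₃) (hc69 : 0 ≤ c69) (hq : 0 ≤ q) {B₀'' : ℝ} (hB₀'' : 0 ≤ B₀'') :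
    ∀ i : {i : ZdIdx d L // ∃ (a : Site d) (M ρ : ℕ), L ≤ ρ ∧ ρ ≤ M ∧ 11 * d < M ∧ L ≤ d * M ∧
        i.Ω = cubeFam false L a M ρ i.k ∧ i.Λs = cubeLamS L a M ρ i.k ∧ i.Λb = cubeLamB L a M ρ i.k},
      (∀ α₀ α₁ : ℝ, 0 < α₀ → 0 < α₁ → α₀ + α₁ ≤ min (min (1 / 16) (min (c₆ / M) (min (a₀ / (K₆ * M)) (min (a₃ / (K₆ * M)) (1 / (2 * B₀ * c69 * K₆ * M + 1)))))) ((min (1 / 16) (min (c₆ / M) (min (a₀ / (K₆ * M)) (min (a₃ / (K₆ * M)) (1 / (2 * B₀ * c69 * K₆ * M + 1)))))) / (2 * (L * (5 * (d : ℝ) * L * max 1 (2 * B₀ * max 1 q))) + 8 * (8 * B₀'' * (5 * (d : ℝ) * L * max 1 (2 * B₀ * max 1 q))))) →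
        ∀ U₀ U' : Site d → Fin d → 𝔸ˣ, (∀ x κ, U₀ x κ ∈ unitaryUnits 𝔸) → (∀ x κ, U' x κ ∈ unitaryUnits 𝔸) →
        InAk L i.1.k i.1.η α₀ i.1.Ω U₀ → InAk L i.1.k i.1.η α₀ i.1.Ω (mulCfg U' U₀) → (∀ m, m ≤ i.1.k → InAx L m (i.1.Λs m) U₀ (mulCfg U' U₀)) →
        (∀ j, j ≤ i.1.k → ∀ (z : Site d) (μ : Fin d), (∀ x, InBox (loK L j z) (bondHiK L j z μ) x → x ∈ i.1.Ω j) →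
          ‖(avgIter L (mulCfg U' U₀) j z μ : 𝔸) - (avgIter L U₀ j z μ : 𝔸)‖ ≤ α₁) →
        (∀ b ∈ {b : Site d × Fin d | SideTouches (i.1.Ω 0) b.1 b.2}, ‖((U' b.1 b.2 : 𝔸ˣ) : 𝔸) - 1‖ ≤ α₁) →
        (∀ m, 1 ≤ m → m ≤ i.1.k → ∀ (u : Site d → 𝔸ˣ) (W : Site d → Fin d → 𝔸ˣ) (A' : Site d → Fin d → 𝔸),
          (∀ x, u x ∈ unitaryUnits 𝔸) → (∀ x, x ∉ i.1.Ω 0 → u x = 1) → mgauge U₀ u W = U' → Restr129 L m (i.1.Λs m) U₀ u →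
          IsLandau138W L m i.1.η (i.1.Ω 0) (i.1.Λs m) U₀ W → (∀ y τ, IsSelfAdjoint (A' y τ)) →
          (∀ j, j ≤ m → ∀ y τ, SideTouches (i.1.Ω j) y τ →
          W y τ = cfgExp i.1.η A' y τ ∧ ‖A' y τ‖ ≤ (2 * (L * (5 * (d : ℝ) * L * (max 1 (2 * B₀ * max 1 q)) * (α₀ + α₁))) + 8 * (8 * B₀'' * (5 * (d : ℝ) * L * (max 1 (2 * B₀ * max 1 q))) * (α₀ + α₁))) * ((L : ℝ) ^ j * i.1.η)⁻¹) →
          (∀ y τ, (∀ j, j ≤ m → ¬ SideTouches (i.1.Ω j) y τ) → A' y τ = 0) →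
          msup L m i.1.η (-(1 : ℝ)) (fun j (b : Site d × Fin d) => SideTouches (i.1.Ω j) b.1 b.2) (fun b => A' b.1 b.2)
          ≤ (max 1 (2 * B₀ * max 1 q)) * (bondNorm L m i.1.η (-(3 : ℝ)) i.1.Ω (fun x μ => Jcur i.1.η U₀ A' μ x)
          + wsup 1 (fun p : {p : ℕ × (Site d × Fin d) // p.1 ≤ m ∧ p.2 ∈ i.1.Λb m p.1} =>
          linCovIter L U₀ (iEta i.1.η A') p.1.1 p.1.2.1 p.1.2.2))
          + ((20 * d + 2) * max 1 (2 * B₀ * max 1 q)) * msup L m i.1.η (-(1 : ℝ)) (fun j (b : Site d × Fin d) => j = 0 ∧ SideTouches (i.1.Ω 0) b.1 b.2 ∧ ¬ BondTouches (i.1.Ω 0) b.1 b.2)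
              (fun b => A' b.1 b.2) ∧
          msup L m i.1.η (-(2 : ℝ)) (fun j (t : Fin d × Fin d × Site d) => SideTouches (i.1.Ω j) t.2.2 t.2.1)
          (fun t => covDerivFwd i.1.η U₀ t.1 (fun z => A' z t.2.1) t.2.2)
          ≤ (max 1 (2 * B₀ * max 1 q)) * (bondNorm L m i.1.η (-(3 : ℝ)) i.1.Ω (fun x μ => Jcur i.1.η U₀ A' μ x)
          + wsup 1 (fun p : {p : ℕ × (Site d × Fin d) // p.1 ≤ m ∧ p.2 ∈ i.1.Λb m p.1} =>
          linCovIter L U₀ (iEta i.1.η A') p.1.1 p.1.2.1 p.1.2.2))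
          + ((20 * d + 2) * max 1 (2 * B₀ * max 1 q)) * msup L m i.1.η (-(1 : ℝ)) (fun j (b : Site d × Fin d) => j = 0 ∧ SideTouches (i.1.Ω 0) b.1 b.2 ∧ ¬ BondTouches (i.1.Ω 0) b.1 b.2)
              (fun b => A' b.1 b.2))) := by
  have hL1 : 1 ≤ L := le_trans (by norm_num) hL
  have hd1 : 1 ≤ d := le_trans (by norm_num) hd2
  have hM0 : 0 < M := lt_of_lt_of_le one_pos hM1
  have hKM : 0 < K₆ * M := mul_pos hK₆ hM0
  -- the cube members have `Margin2` (ρ ≥ L ≥ 2)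
  have hMJ : ∀ i : {i : ZdIdx d L // ∃ (a : Site d) (M ρ : ℕ), L ≤ ρ ∧ ρ ≤ M ∧ 11 * d < M ∧ L ≤ d * M ∧
        i.Ω = cubeFam false L a M ρ i.k ∧ i.Λs = cubeLamS L a M ρ i.k ∧ i.Λb = cubeLamB L a M ρ i.k}, Margin2 i.1.Ω := by
    rintro ⟨i, a, M, ρ, hρ, -, -, -, hΩ, -, -⟩
    dsimp only
    rw [hΩ]
    exact B9SupplySockB9P3ZdLettersOmega.margin2_cubeFam L a M (hL.trans hρ) i.k
  have hall := sockB9P3D4_allLevels_explicit_on geo bg GA L mem ιCfg ιLoc ops hd2 hL1 hB₀ H hM1 hMM₁ hMM₃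
    (fun i : {i : ZdIdx d L // ∃ (a : Site d) (M ρ : ℕ), L ≤ ρ ∧ ρ ≤ M ∧ 11 * d < M ∧ L ≤ d * M ∧
        i.Ω = cubeFam false L a M ρ i.k ∧ i.Λs = cubeLamS L a M ρ i.k ∧ i.Λb = cubeLamB L a M ρ i.k} => i.1) hMJ
    hdict hP6 hinv hcurv hlan havg hK₆ hc69 hq
  have hB' : 0 < max 1 (2 * B₀ * max 1 q) := lt_of_lt_of_le one_pos (le_max_left _ _)
  have hcP : 0 < min (1 / 16) (min (c₆ / M) (min (a₀ / (K₆ * M)) (min (a₃ / (K₆ * M)) (1 / (2 * B₀ * c69 * K₆ * M + 1))))) := by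
    refine lt_min (by norm_num) (lt_min (div_pos hc₆ hM0) (lt_min (div_pos ha₀ hKM) (lt_min (div_pos ha₃ hKM) ?_)))
    have : 0 < 2 * B₀ * c69 * K₆ * M + 1 := by positivity
    positivity
  intro i
  exact B9SupplySockB9P3ZdOmega.sockH59D_of_allLevelsD4 hd1 hL1 hB' hB₀'' hcP (fun m hm => hall i m hm)

/-- ★★ **THE ONE-B₀ SUPPLIER FOR dag-n05-e's CUBE LINE (`B8LeafKnitZd3CubBdry4.prop6Printed_zdCub_bdry₅_d4` shares `inp.B₀`, `Bbd`, `cP` between `SH59D` and the per-cube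
four-line clause): THE FOUR-LINE COLLAR FAMILY ∧ `SH59D` FROM [4] THEOREM 3.3 BY NAME WITH A SINGLE CONSTANT TUPLE.**  Over the cube subtype of (1.131),
`B9.Thm33Printed c35 geo bg Gp GA` + `DictAt`, `Prop6At`, `InvAt`, `CurvAt`, `LandauAt`, `AvgAt` on that subtype give ONE pair `(B₀, cP)` with: (i)
`SockB9P3D4 L B₀′ ((20d+2)B₀′) cP …` at every cube member and every `m ≤ k`; (ii) for EVERY `B₀″ ≥ 0` the consumer fixes afterwards (its `inp.B₀′`), a threshold
`0 < c59 ≤ cP` with the `SH59D` body at `(B₀′, B₀″, (20d+2)B₀′, c59)`.  B₀′ = max{1, 2B₀max{1,q}}; the consumer's window `4B_∂ ≤ (dL − 1)B₀′` reads `80d + 8 ≤ dL − 1`.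
[cite: Balaban1985RegularSpaces, Thm 4 p.88, Prop. 6 p.99, (1.131)–(1.133) p.99, (1.59) p.86; Balaban1985BackgroundPropagators, Thm 3.3 p.399, (3.27) p.395] -/
theorem sockCube_joint_of_thm33_on (hd2 : 2 ≤ d) {L : ℕ} (hL : 2 ≤ L)
    {I : Type} (geo : I → B9.Geometry) (bg : I → B9.Backgrounds) (GA : ∀ i, B9.KernelFamily (geo i) (bg i))
    (mem : ℝ → ZdIdx d L → ℕ → I)
    (ιCfg : ∀ (M : ℝ) (i : ZdIdx d L) (m : ℕ) (U₀ : Site d → Fin d → 𝔸ˣ), (∀ x κ, U₀ x κ ∈ unitaryUnits 𝔸) → (bg (mem M i m)).Cfg)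
    (ιLoc : ∀ (M : ℝ) (i : ZdIdx d L) (m : ℕ), (Site d → Fin d → 𝔸) → (geo (mem M i m)).Loc)
    (ops : ℝ → ZdIdx d L → ℕ → OpsZd d 𝔸) {c35 c₆ K₆ M₃ a₃ c69 q : ℝ}
    {Gp : ∀ i, B9.KernelFamily (geo i) (bg i)} (h33 : B9.Thm33Printed c35 geo bg Gp GA)
    (hdict : ∀ (M' : ℝ) (i : {i : ZdIdx d L // ∃ (a : Site d) (M ρ : ℕ), L ≤ ρ ∧ ρ ≤ M ∧ 11 * d < M ∧ L ≤ d * M ∧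
        i.Ω = cubeFam false L a M ρ i.k ∧ i.Λs = cubeLamS L a M ρ i.k ∧ i.Λb = cubeLamB L a M ρ i.k}) (m : ℕ),
      DictAt geo bg GA L mem ιCfg ιLoc ops M' i.1 m)
    (hP6 : ∀ (M' : ℝ) (i : {i : ZdIdx d L // ∃ (a : Site d) (M ρ : ℕ), L ≤ ρ ∧ ρ ≤ M ∧ 11 * d < M ∧ L ≤ d * M ∧
        i.Ω = cubeFam false L a M ρ i.k ∧ i.Λs = cubeLamS L a M ρ i.k ∧ i.Λb = cubeLamB L a M ρ i.k}) (m : ℕ),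
      M₃ ≤ M' → Prop6At bg L mem ιCfg c35 c₆ K₆ M' i.1 m)
    (hinv : ∀ (M' : ℝ) (i : {i : ZdIdx d L // ∃ (a : Site d) (M ρ : ℕ), L ≤ ρ ∧ ρ ≤ M ∧ 11 * d < M ∧ L ≤ d * M ∧
        i.Ω = cubeFam false L a M ρ i.k ∧ i.Λs = cubeLamS L a M ρ i.k ∧ i.Λb = cubeLamB L a M ρ i.k}) (m : ℕ),
      M₃ ≤ M' → InvAt bg L mem ιCfg ops c35 a₃ M' i.1 m)
    (hcurv : ∀ (M' : ℝ) (i : {i : ZdIdx d L // ∃ (a : Site d) (M ρ : ℕ), L ≤ ρ ∧ ρ ≤ M ∧ 11 * d < M ∧ L ≤ d * M ∧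
        i.Ω = cubeFam false L a M ρ i.k ∧ i.Λs = cubeLamS L a M ρ i.k ∧ i.Λb = cubeLamB L a M ρ i.k}) (m : ℕ),
      M₃ ≤ M' → CurvAt bg L mem ιCfg ops c35 a₃ c69 M' i.1 m)
    (hlan : ∀ (M' : ℝ) (i : {i : ZdIdx d L // ∃ (a : Site d) (M ρ : ℕ), L ≤ ρ ∧ ρ ≤ M ∧ 11 * d < M ∧ L ≤ d * M ∧
        i.Ω = cubeFam false L a M ρ i.k ∧ i.Λs = cubeLamS L a M ρ i.k ∧ i.Λb = cubeLamB L a M ρ i.k}) (m : ℕ),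
      M₃ ≤ M' → LandauAt bg L mem ιCfg ops c35 a₃ M' i.1 m)
    (havg : ∀ (M' : ℝ) (i : {i : ZdIdx d L // ∃ (a : Site d) (M ρ : ℕ), L ≤ ρ ∧ ρ ≤ M ∧ 11 * d < M ∧ L ≤ d * M ∧
        i.Ω = cubeFam false L a M ρ i.k ∧ i.Λs = cubeLamS L a M ρ i.k ∧ i.Λb = cubeLamB L a M ρ i.k}) (m : ℕ),
      AvgAt L ops q M' i.1 m)
    (hc₆ : 0 < c₆) (hK₆ : 0 < K₆) (ha₃ : 0 < a₃) (hc69 : 0 ≤ c69) (hq : 0 ≤ q) :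
    ∃ B₀ cP : ℝ, 0 < B₀ ∧ 0 < cP ∧
      (∀ (i : {i : ZdIdx d L // ∃ (a : Site d) (M ρ : ℕ), L ≤ ρ ∧ ρ ≤ M ∧ 11 * d < M ∧ L ≤ d * M ∧
        i.Ω = cubeFam false L a M ρ i.k ∧ i.Λs = cubeLamS L a M ρ i.k ∧ i.Λb = cubeLamB L a M ρ i.k}) (m : ℕ), m ≤ i.1.k →
        SockB9P3D4 (𝔸 := 𝔸) L (max 1 (2 * B₀ * max 1 q)) ((20 * d + 2) * max 1 (2 * B₀ * max 1 q)) cP i.1.η m i.1.Ω i.1.Λs i.1.Λb) ∧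
      (∀ B₀'' : ℝ, 0 ≤ B₀'' → ∃ c59 : ℝ, 0 < c59 ∧ c59 ≤ cP ∧
    ∀ i : {i : ZdIdx d L // ∃ (a : Site d) (M ρ : ℕ), L ≤ ρ ∧ ρ ≤ M ∧ 11 * d < M ∧ L ≤ d * M ∧
        i.Ω = cubeFam false L a M ρ i.k ∧ i.Λs = cubeLamS L a M ρ i.k ∧ i.Λb = cubeLamB L a M ρ i.k},
      (∀ α₀ α₁ : ℝ, 0 < α₀ → 0 < α₁ → α₀ + α₁ ≤ c59 →
        ∀ U₀ U' : Site d → Fin d → 𝔸ˣ, (∀ x κ, U₀ x κ ∈ unitaryUnits 𝔸) → (∀ x κ, U' x κ ∈ unitaryUnits 𝔸) →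
        InAk L i.1.k i.1.η α₀ i.1.Ω U₀ → InAk L i.1.k i.1.η α₀ i.1.Ω (mulCfg U' U₀) → (∀ m, m ≤ i.1.k → InAx L m (i.1.Λs m) U₀ (mulCfg U' U₀)) →
        (∀ j, j ≤ i.1.k → ∀ (z : Site d) (μ : Fin d), (∀ x, InBox (loK L j z) (bondHiK L j z μ) x → x ∈ i.1.Ω j) →
          ‖(avgIter L (mulCfg U' U₀) j z μ : 𝔸) - (avgIter L U₀ j z μ : 𝔸)‖ ≤ α₁) →
        (∀ b ∈ {b : Site d × Fin d | SideTouches (i.1.Ω 0) b.1 b.2}, ‖((U' b.1 b.2 : 𝔸ˣ) : 𝔸) - 1‖ ≤ α₁) →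
        (∀ m, 1 ≤ m → m ≤ i.1.k → ∀ (u : Site d → 𝔸ˣ) (W : Site d → Fin d → 𝔸ˣ) (A' : Site d → Fin d → 𝔸),
          (∀ x, u x ∈ unitaryUnits 𝔸) → (∀ x, x ∉ i.1.Ω 0 → u x = 1) → mgauge U₀ u W = U' → Restr129 L m (i.1.Λs m) U₀ u →
          IsLandau138W L m i.1.η (i.1.Ω 0) (i.1.Λs m) U₀ W → (∀ y τ, IsSelfAdjoint (A' y τ)) →
          (∀ j, j ≤ m → ∀ y τ, SideTouches (i.1.Ω j) y τ →
          W y τ = cfgExp i.1.η A' y τ ∧ ‖A' y τ‖ ≤ (2 * (L * (5 * (d : ℝ) * L * (max 1 (2 * B₀ * max 1 q)) * (α₀ + α₁))) + 8 * (8 * B₀'' * (5 * (d : ℝ) * L * (max 1 (2 * B₀ * max 1 q))) * (α₀ + α₁))) * ((L : ℝ) ^ j * i.1.η)⁻¹) →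
          (∀ y τ, (∀ j, j ≤ m → ¬ SideTouches (i.1.Ω j) y τ) → A' y τ = 0) →
          msup L m i.1.η (-(1 : ℝ)) (fun j (b : Site d × Fin d) => SideTouches (i.1.Ω j) b.1 b.2) (fun b => A' b.1 b.2)
          ≤ (max 1 (2 * B₀ * max 1 q)) * (bondNorm L m i.1.η (-(3 : ℝ)) i.1.Ω (fun x μ => Jcur i.1.η U₀ A' μ x)
          + wsup 1 (fun p : {p : ℕ × (Site d × Fin d) // p.1 ≤ m ∧ p.2 ∈ i.1.Λb m p.1} =>
          linCovIter L U₀ (iEta i.1.η A') p.1.1 p.1.2.1 p.1.2.2))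
          + ((20 * d + 2) * max 1 (2 * B₀ * max 1 q)) * msup L m i.1.η (-(1 : ℝ)) (fun j (b : Site d × Fin d) => j = 0 ∧ SideTouches (i.1.Ω 0) b.1 b.2 ∧ ¬ BondTouches (i.1.Ω 0) b.1 b.2)
              (fun b => A' b.1 b.2) ∧
          msup L m i.1.η (-(2 : ℝ)) (fun j (t : Fin d × Fin d × Site d) => SideTouches (i.1.Ω j) t.2.2 t.2.1)
          (fun t => covDerivFwd i.1.η U₀ t.1 (fun z => A' z t.2.1) t.2.2)
          ≤ (max 1 (2 * B₀ * max 1 q)) * (bondNorm L m i.1.η (-(3 : ℝ)) i.1.Ω (fun x μ => Jcur i.1.η U₀ A' μ x)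
          + wsup 1 (fun p : {p : ℕ × (Site d × Fin d) // p.1 ≤ m ∧ p.2 ∈ i.1.Λb m p.1} =>
          linCovIter L U₀ (iEta i.1.η A') p.1.1 p.1.2.1 p.1.2.2))
          + ((20 * d + 2) * max 1 (2 * B₀ * max 1 q)) * msup L m i.1.η (-(1 : ℝ)) (fun j (b : Site d × Fin d) => j = 0 ∧ SideTouches (i.1.Ω 0) b.1 b.2 ∧ ¬ BondTouches (i.1.Ω 0) b.1 b.2)
              (fun b => A' b.1 b.2)))) := by
  have hL1 : 1 ≤ L := le_trans (by norm_num) hL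
  have hd1 : 1 ≤ d := le_trans (by norm_num) hd2
  obtain ⟨M₁, δ₀, a₀, B₀, Bβ, Bε, Bεβ, -, -, ha₀, hB₀, H⟩ := h33
  have H' : ∀ i : I, M₁ ≤ (geo i).M → ∀ α₀ : ℝ, 0 < α₀ → (geo i).M * α₀ ≤ a₀ →
      ∀ U : (bg i).Cfg, (bg i).Reg335 c35 α₀ U →
        B9.Ineq342_346_347 (GA i) B₀ δ₀ U ∧ B9.Ineq343_345 (GA i) Bβ Bε Bεβ δ₀ U :=
    fun i hMi α₀ hα₀ hMa U hreg => (H i hMi α₀ hα₀ hMa U hreg).2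
  obtain ⟨M, hM_def⟩ : ∃ M : ℝ, M = max 1 (max M₁ M₃) := ⟨_, rfl⟩
  have hM1 : 1 ≤ M := by rw [hM_def]; exact le_max_left _ _
  have hMM₁ : M₁ ≤ M := by rw [hM_def]; exact (le_max_left _ _).trans (le_max_right _ _)
  have hMM₃ : M₃ ≤ M := by rw [hM_def]; exact (le_max_right _ _).trans (le_max_right _ _)
  have hM0 : 0 < M := lt_of_lt_of_le one_pos hM1
  have hKM : 0 < K₆ * M := mul_pos hK₆ hM0
  -- the cube members have `Margin2` (ρ ≥ L ≥ 2)
  have hMJ : ∀ i : {i : ZdIdx d L // ∃ (a : Site d) (M ρ : ℕ), L ≤ ρ ∧ ρ ≤ M ∧ 11 * d < M ∧ L ≤ d * M ∧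
        i.Ω = cubeFam false L a M ρ i.k ∧ i.Λs = cubeLamS L a M ρ i.k ∧ i.Λb = cubeLamB L a M ρ i.k}, Margin2 i.1.Ω := by
    rintro ⟨i, a, M, ρ, hρ, -, -, -, hΩ, -, -⟩
    dsimp only
    rw [hΩ]
    exact B9SupplySockB9P3ZdLettersOmega.margin2_cubeFam L a M (hL.trans hρ) i.k
  have hall := sockB9P3D4_allLevels_explicit_on geo bg GA L mem ιCfg ιLoc ops hd2 hL1 hB₀ H' hM1 hMM₁ hMM₃
    (fun i : {i : ZdIdx d L // ∃ (a : Site d) (M ρ : ℕ), L ≤ ρ ∧ ρ ≤ M ∧ 11 * d < M ∧ L ≤ d * M ∧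
        i.Ω = cubeFam false L a M ρ i.k ∧ i.Λs = cubeLamS L a M ρ i.k ∧ i.Λb = cubeLamB L a M ρ i.k} => i.1) hMJ
    hdict hP6 hinv hcurv hlan havg hK₆ hc69 hq
  have hB' : 0 < max 1 (2 * B₀ * max 1 q) := lt_of_lt_of_le one_pos (le_max_left _ _)
  have hcP : 0 < min (1 / 16) (min (c₆ / M) (min (a₀ / (K₆ * M)) (min (a₃ / (K₆ * M)) (1 / (2 * B₀ * c69 * K₆ * M + 1))))) := by
    refine lt_min (by norm_num) (lt_min (div_pos hc₆ hM0) (lt_min (div_pos ha₀ hKM) (lt_min (div_pos ha₃ hKM) ?_)))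
    have : 0 < 2 * B₀ * c69 * K₆ * M + 1 := by positivity
    positivity
  refine ⟨B₀, _, hB₀, hcP, hall, fun B₀'' hB₀'' => ?_⟩
  have hK₀ : 0 < (2 * (L * (5 * (d : ℝ) * L * max 1 (2 * B₀ * max 1 q))) + 8 * (8 * B₀'' * (5 * (d : ℝ) * L * max 1 (2 * B₀ * max 1 q)))) := by
    have h0 : (0 : ℝ) < L := by exact_mod_cast (lt_of_lt_of_le one_pos hL1)
    have h0' : (0 : ℝ) < d := by exact_mod_cast (lt_of_lt_of_le one_pos hd1)
    have h1 : 0 < 2 * (L * (5 * (d : ℝ) * L * max 1 (2 * B₀ * max 1 q))) := by positivity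
    have h2 : 0 ≤ 8 * (8 * B₀'' * (5 * (d : ℝ) * L * max 1 (2 * B₀ * max 1 q))) := by positivity
    linarith
  exact ⟨_, lt_min hcP (div_pos hcP hK₀), min_le_left _ _, fun i =>
    B9SupplySockB9P3ZdOmega.sockH59D_of_allLevelsD4 hd1 hL1 hB' hB₀'' hcP (fun m hm => hall i m hm)⟩

end Bridge

#print axioms sockB9P3D4_allLevels_explicit_on
#print axioms sockB9P3_allLevels_univ_explicit_on
#print axioms sockB9P3srcH_univ_explicit_on
#print axioms sockH59src_univ_explicit_on
#print axioms sockUniv_joint_of_thm33_on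
#print axioms sh59D_cube_explicit_on
#print axioms sockCube_joint_of_thm33_on

end Literature.MathematicalPhysics.QuantumFieldTheory.Balaban1983to89.B9SupplySockB9P3ZdAtJoint

end
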